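import Literature.NumberTheory.DiophantineGeometry.BcgpSwitchExistsModularAbelianSurface
import Literature.NumberTheory.DiophantineGeometry.GenusTwoTwoTorsionS5b
import Literature.NumberTheory.GaloisRepresentations.OrdinaryPDistinguished
import Literature.NumberTheory.DiophantineGeometry.AVTorsionCharpolyReductionProofs
import Literature.NumberTheory.GaloisRepresentations.SymplecticOrdinaryBlocksProofs
import Literature.NumberTheory.GaloisRepresentations.LocalKroneckerWeberInertiaProofs
import Literature.NumberTheory.GaloisRepresentations.ModPGaloisRepCyclotomicProofs
import Literature.NumberTheory.GaloisRepresentations.ModNCyclotomicCharacter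
import Literature.NumberTheory.GaloisRepresentations.TameInertiaProofs
import Literature.NumberTheory.GaloisRepresentations.IntegralGaloisActionProofs
import Literature.NumberTheory.GaloisRepresentations.LocalField
import Literature.NumberTheory.Automorphic.AdicCompletionResidueCard
import Literature.NumberTheory.GaloisRepresentations.GSpValued
import Literature.NumberTheory.DiophantineGeometry.AVIsogenyTateHomProofs
import Literature.NumberTheory.GaloisRepresentations.GaloisRepFrobeniusProofs
import Literature.NumberTheory.GaloisRepresentations.FramedRepBaseChange
import Literature.NumberTheory.DiophantineGeometry.AVIsogenyTateHoldsProofs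
import Literature.NumberTheory.DiophantineGeometry.GenusTwoTwoTorsionS5bProofs
import Literature.NumberTheory.DiophantineGeometry.BcgpSwitchingSurface
import Literature.NumberTheory.DiophantineGeometry.BcgpResiduallyA5bModular
import Mathlib.RingTheory.Nakayama
import HarnessLib

/-!
# `bcgp_switch_exists_modular_abelianSurface`: the characteristic-polynomial clause is
# conclusion (2)(a) "`ρ̄_{B,3} ≅ ρ̄`" of BCGP Lemma 9.4.2 (proofs)

Topic `NumberTheory/DiophantineGeometry`; `…Proofs` companion (theorems only, no definition, no
named fact, no `sorry`) of `BcgpSwitchExistsModularAbelianSurface`, landed by the seat of the named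
fact `Literature.NumberTheory.DiophantineGeometry.bcgp_switch_exists_modular_abelianSurface`
(G. Boxer, F. Calegari, T. Gee, V. Pilloni, *Modularity theorems for abelian surfaces*,
arXiv:2502.20645 (2025): Lemma 9.4.2 (2) with its "Moreover", Thm. 8.3.2, and the transfer
`GSp₄ → GL₄` as in the proof of Thm. 9.5.2).

## Status of the fact (census of this seat)

The fact is a faithful rendering of a PUBLISHED and PROVED theorem whose proof is a theory absent
from Mathlib and from the tree (fine moduli `P(ρ̄)`, `𝓜₂ʷ(ρ̄)` of [BCGP2018, §10.2] and their
rationality; Ekedahl–Serre thin-set approximation, Lemma 9.4.1; Kisin's Krasner lemma and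
Serre–Tate lifting, §9.2–§9.3; Zarhin's `End(B_ℚ̄) = ℤ`; the 2-adic modularity lifting theorem
Thm. 8.3.2 = §§2–8 of the paper; Arthur's transfer and local-global compatibility, §1.8.9–1.8.10).
It therefore stays a cited named fact.  Exactly ONE step of the printed argument lives in the
tree's vocabulary, the bookkeeping of §1.8.11,

> "`T_p(A)` […] `ρ_{A,p}^∨`", "`ρ̄_{A,p} : G_F → GSp₄(𝔽_p)`" on "`A[p]^∨ = H¹(A_{F̄}, 𝔽_p)`",

by which conclusion (2)(a) of Lemma 9.4.2, "`ρ̄_{B,3} ≅ ρ̄`", produces the clause of the tree's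
statement recording it:

> for the framed `r(g) = [g⁻¹]_bᵀ` on `H¹_ét(B_ℚ̄, ℚ̄₃) = (V₃ B)^∨ ⊗ ℚ̄₃` in the dual basis of ANY
> `ℚ₃`-basis `b` of `V₃ B`, every `det(X - r(g))` lies in `ℤ₃[X]` and reduces mod `3` to
> `det(X - ρ̄(g))`.

This file PROVES that implication — in general form for any abelian variety over any field, any
prime `p` invertible in it and any dimension
(`AbelianVariety.exists_map_eq_charpoly_dualFrame_and_map_eq_charpoly`), and in the exact shape of
the fact (`bcgp_switch_charpolyClause_of_dualTorsionFrame`, `bcgp_switch_charpolyClause`, abelian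
surfaces `B/ℚ`, `p = 3`) — from the tree's theorem
`AbelianVariety.exists_charpoly_toMatrix_rationalTateRep_eq_map_and_map_eq_charpoly_torsionFrame`
(`AVTorsionCharpolyReductionProofs`: `T₃ B / 3 = B[3]` as Galois modules, `V₃ = T₃ ⊗ ℚ₃`,
Serre–Tate 1968, §1), so that a future formalisation of Lemma 9.4.2 may state (2)(a) literally.

## Parts 2–4 (appended by the same seat)

* Part 2: conclusion (2)(a) taken LITERALLY as a frame of the dual module `B[3]^∨`
  (`bcgp_switch_charpolyClause_of_dualModuleFrame`).
* Part 3: the hypothesis at `3` unpacked — with hypothesis (1) the block frame condition carries the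
  printed "ordinary" shape of Cor. 9.3.5 (sub Lagrangian, quotient `ε̄⁻¹ ⊗ (sub)^∨`), and its
  third clause is redundant (`bcgp_switch_hypothesisAtThree_quotientBlock`,
  `bcgp_switch_hypothesisAtThree_inertia_quotient`).
* Part 4: the three hypotheses are simultaneously SATISFIABLE in the tree's rendering, by
  `ρ̄ = 𝟙 ⊕ 𝟙 ⊕ ε̄⁻¹ ⊕ ε̄⁻¹` (`bcgp_switch_hypotheses_nonvacuous`): the cited fact is not vacuously
  true, so it is exactly as strong as its conclusion
  (`bcgp_switch_exists_modular_abelianSurface_imp_exists_conclusion`).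
* Part 5: hypothesis (1) ⟺ some conjugate is `GSp₄(𝔽₃)`-valued for BCGP's own `J` (§1.8.6)
  with similitude `ε̄⁻¹` (`bcgp_switch_hypothesisOne_iff_exists_conj_gsp4`); "Moreover
  `End(B_ℚ̄) = ℤ`" ⟹ the endomorphism clause (`bcgp_switch_endClause_of_geomEnd`).
* Part 6: hypothesis (3) ⟺ "unramified at `v` and `frobCharpoly ρ̄ v ≠ (X² ± X + 2)²`"
  (`bcgp_switch_hypothesisAtTwo_iff_frobCharpoly`).
* Part 7: the pair `(b, r)` of the conclusion exists for every `B`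
  (`AbelianVariety.exists_basis_dualFramedRationalTateRep`); consumable form of the fact with the
  frame instantiated (`bcgp_switch_exists_modular_abelianSurface_elim`).
* Part 8: `ρ̄` is residually automorphic — the Satake polynomials of a cuspidal L-algebraic `π`
  on `GL₄/ℚ` are `3`-integral at almost all `v` and reduce to `det(X - ρ̄(Frob_v))`
  (`bcgp_switch_residually_automorphic`).
* Part 9: entry point with the lighter hypotheses (two block clauses at `3`; `frobCharpoly` form
  at `2`): `bcgp_switch_exists_modular_abelianSurface_elim'`.
* Part 10: the fact from its two printed ingredients, Lemma 9.4.2 (2)+"Moreover" and Thm. 8.3.2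
  (`GL₄` form), both stated inline as hypotheses
  (`bcgp_switch_exists_modular_abelianSurface_of_lemma942_of_theorem832`).
* Part 11: the "Moreover" is not needed — `End_ℚ(B) = ℤ · 𝟙` is PROVED from Lemma 9.4.2 (2)(d)
  (`A₅(b) ⊆ im ρ̄_{B,2}`: Lemma 8.1.1 / Schur on `B[2]`, Milne's Lemma 12.6, finite generation of
  `End(B)` and Nakayama — the `K`-rational half of Zarhin 2000, §3), generically for any abelian
  variety in characteristic `0` (`AbelianVariety.forall_end_eq_zsmul_id_of_forall_geomTorsion_eq_zsmul`,
  `AbelianVariety.forall_end_eq_zsmul_id_of_s5bFrame`), whence the fact from Lemma 9.4.2 (2)(a)–(d)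
  and Thm. 8.3.2 alone (`bcgp_switch_exists_modular_abelianSurface_of_lemma942abcd_of_theorem832`).
* Part 12: Schur's lemma for absolutely irreducible matrix representations
  (`IsAbsIrreducible.exists_eq_scalar_of_forall_commute`) and the general form of Zarhin 2000, §1:
  `A[ℓ](K̄)` absolutely irreducible ⟹ `End_K(A) = ℤ · 𝟙`
  (`AbelianVariety.forall_end_eq_zsmul_id_of_isAbsIrreducible_torsionFrame`).

## The hypothesis "`ρ̄_{B,3} ≅ ρ̄`" in tree terms

`ρ̄_{B,3}` is the representation of `Γ_ℚ` on `B[3]^∨ = Hom(B[3](ℚ̄), 𝔽₃)` (loc. cit. §1.8.11: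
`A[p] ≅ ρ̄^∨`, Def. 9.2.1: "a symplectic isomorphism `A[3] ≃ ρ̄^∨`").  An isomorphism of
`𝔽₃[Γ_ℚ]`-modules `B[3]^∨ ≅ ρ̄` is a basis of `B[3]^∨` in which `g` acts through `ρ̄(g)`;
in the DUAL basis of `B[3]` the element `g` then acts through the contragredient
`(ρ̄(g)⁻¹)ᵀ = ρ̄(g⁻¹)ᵀ`.  We therefore take "`ρ̄_{B,3} ≅ ρ̄`" as an additive frame
`e : B[3](ℚ̄) ≃ (ℤ/3)⁴` with `e (g • P) = ρ̄(g⁻¹)ᵀ · e(P)` (the shape of the tree's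
`WeierstrassCurve.IsTorsionGaloisRep`, for the contragredient); the symplecticity of the printed
isomorphism is not needed for this clause.

## References

* [BoxerCalegariGeePilloni2025] G. Boxer, F. Calegari, T. Gee, V. Pilloni, *Modularity theorems
  for abelian surfaces*, arXiv:2502.20645: Lemma 9.4.2, §1.8.11, Def. 9.2.1, proof of Thm. 9.5.2.
* [SerreTate1968] J.-P. Serre, J. Tate, *Good reduction of abelian varieties*, Ann. of Math. 88
  (1968), §1.
* [Zarhin2000] Yu. G. Zarhin, *Hyperelliptic Jacobians without complex multiplication*, Math. Res.
  Lett. 7 (2000), 123–132 (MR1748293), §1 and §3 (Part 11).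

## Design

Pure theorems in the file's path namespace; `3`-torsion written `B.geomTorsion (3 : ℕ)` (the
subgroup `A[↑(3 : ℕ)]` of the generic Tate-module library); axioms `propext`, `Classical.choice`,
`Quot.sound`.
-/

noncomputable section

open scoped Matrix NumberField TensorProduct
open Literature.NumberTheory.GaloisRepresentations
open Literature.AlgebraicGeometry.Motives (AbelianVariety)
open Literature.AlgebraicGeometry.Motives.AbelianVariety
open Literature.NumberTheory.EllipticCurves

namespace Literature.NumberTheory.DiophantineGeometry

/-- **Dual (cohomological) frames: integrality and reduction of `det(X - r(g))`, any abelian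
variety.**  Let `B/K` be an abelian variety, `p` a prime invertible in `K`, `d = 2 dim B`.  Suppose
the `p`-torsion is framed by the CONTRAGREDIENT of a matrix-valued `ρ̄` on `Γ_K`
(`e (g • P) = ρ̄(g⁻¹)ᵀ · e(P)`, i.e. `ρ̄` is the matrix of `Γ_K` on `B[p]^∨` in the basis dual to
`e`, BCGP §1.8.11: "`A[p]^∨`", "`ρ̄_{A,p}`"), and let `r(g) = [g⁻¹]_bᵀ ⊗ ℚ̄_p` be the matrices of
`Γ_K` on `(V_p B)^∨ ⊗ ℚ̄_p = H¹_ét(B_K̄, ℚ̄_p)` in the basis dual to a `ℚ_p`-basis `b` of `V_p B`.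
Then for every `g`, `P := charpoly(g⁻¹ | T_p B) ∈ ℤ_p[X]` maps to `det(X - r(g))` in `ℚ̄_p[X]`
and reduces mod `p` to `det(X - ρ̄(g))`.  From
`exists_charpoly_toMatrix_rationalTateRep_eq_map_and_map_eq_charpoly_torsionFrame`
(`AVTorsionCharpolyReductionProofs`; Serre–Tate 1968, §1) at `g⁻¹`, `IsScalarTower.algebraMap_eq`
and `Matrix.charpoly_transpose`. [cite: SerreTate1968, §1] -/
theorem _root_.Literature.AlgebraicGeometry.Motives.AbelianVariety.exists_map_eq_charpoly_dualFrame_and_map_eq_charpoly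
    {K : Type*} [Field K] (B : AbelianVariety K) (p : ℕ) [Fact p.Prime] (hp : (p : K) ≠ 0)
    {d : ℕ} (hd : 2 * B.dim = d)
    (ρb : Field.absoluteGaloisGroup K → Matrix (Fin d) (Fin d) (ZMod p))
    (e : B.geomTorsion (p : ℕ) ≃+ (Fin d → ZMod p))
    (he : ∀ (g : Field.absoluteGaloisGroup K) (P : B.geomTorsion (p : ℕ)),
      e (g • P) = (ρb g⁻¹)ᵀ *ᵥ e P)
    (b : Module.Basis (Fin d) ℚ_[p] (B.rationalTateModule p))
    (r : Field.absoluteGaloisGroup K → Matrix (Fin d) (Fin d) (PadicAlgCl p))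
    (hr : ∀ g : Field.absoluteGaloisGroup K,
      r g = ((LinearMap.toMatrix b b (B.rationalTateRep p g⁻¹)).map
        (algebraMap ℚ_[p] (PadicAlgCl p)))ᵀ)
    (g : Field.absoluteGaloisGroup K) :
    ∃ P : Polynomial ℤ_[p],
      P.map (algebraMap ℤ_[p] (PadicAlgCl p)) = (r g).charpoly ∧
        P.map PadicInt.toZMod = (ρb g).charpoly := by
  obtain ⟨P, hPV, hPbar⟩ :=
    B.exists_charpoly_toMatrix_rationalTateRep_eq_map_and_map_eq_charpoly_torsionFrame p hp hd e
      (fun h ↦ (ρb h⁻¹)ᵀ) he b g⁻¹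
  refine ⟨P, ?_, ?_⟩
  · rw [hr g, Matrix.charpoly_transpose, Matrix.charpoly_map, ← hPV, Polynomial.map_map,
      ← IsScalarTower.algebraMap_eq]
  · rw [hPbar, inv_inv, Matrix.charpoly_transpose]

/-- **BCGP Lemma 9.4.2 (2)(a) ⟹ the characteristic-polynomial clause of
`bcgp_switch_exists_modular_abelianSurface`.**  Let `B/ℚ` be an abelian surface, `ρ̄ : Γ_ℚ → GL₄(𝔽₃)`
framed, and suppose `ρ̄_{B,3} ≅ ρ̄`, i.e. (`§1.8.11`, dual basis) there is an additive frame
`e : B[3](ℚ̄) ≃ (ℤ/3)⁴` with `e (g • P) = ρ̄(g⁻¹)ᵀ · e(P)`.  Then for ANY `ℚ₃`-basis `b` of `V₃ B`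
and the framed `r : Γ_ℚ → GL₄(ℚ̄₃)` with `r(g) = [g⁻¹]_bᵀ` (the representation on
`H¹_ét(B_ℚ̄, ℚ̄₃) = (V₃ B)^∨ ⊗ ℚ̄₃` in the dual basis), every `det(X - r(g))` is the image of a
polynomial `P ∈ ℤ₃[X]` — namely `P = charpoly(g⁻¹ | T₃ B)` — whose reduction mod `3` is
`det(X - ρ̄(g))`.  The case `K = ℚ`, `p = 3`, `d = 4` of
`AbelianVariety.exists_map_eq_charpoly_dualFrame_and_map_eq_charpoly` (this file; from
`T₃ B/3 = B[3]`, `V₃ B = T₃ B ⊗ ℚ₃`, Serre–Tate 1968, §1).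
[cite: BoxerCalegariGeePilloni2025, Lemma 9.4.2 (2)(a) and §1.8.11] -/
theorem bcgp_switch_charpolyClause_of_dualTorsionFrame (B : AbelianVariety ℚ) (hB : B.dim = 2)
    (ρb : FramedGaloisRep ℚ (ZMod 3) 4)
    (e : B.geomTorsion (3 : ℕ) ≃+ (Fin 4 → ZMod 3))
    (he : ∀ (g : Field.absoluteGaloisGroup ℚ) (P : B.geomTorsion (3 : ℕ)),
      e (g • P) = ((ρb g⁻¹ : GL (Fin 4) (ZMod 3)) : Matrix (Fin 4) (Fin 4) (ZMod 3))ᵀ *ᵥ e P)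
    (b : Module.Basis (Fin 4) ℚ_[3] (B.rationalTateModule 3))
    (r : FramedGaloisRep ℚ (PadicAlgCl 3) 4)
    (hr : ∀ g : Field.absoluteGaloisGroup ℚ,
      (r g).val = ((LinearMap.toMatrix b b (B.rationalTateRep 3 g⁻¹)).map
        (algebraMap ℚ_[3] (PadicAlgCl 3))).transpose)
    (g : Field.absoluteGaloisGroup ℚ) :
    ∃ P : Polynomial ℤ_[3],
      P.map (algebraMap ℤ_[3] (PadicAlgCl 3)) = FramedRep.charpoly r g ∧
        P.map (PadicInt.toZMod (p := 3)) = FramedRep.charpoly ρb g := by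
  have h3 : ((3 : ℕ) : ℚ) ≠ 0 := by norm_num
  have hd : 2 * B.dim = 4 := by rw [hB]
  exact B.exists_map_eq_charpoly_dualFrame_and_map_eq_charpoly 3 h3 hd
    (fun h ↦ ((ρb h : GL (Fin 4) (ZMod 3)) : Matrix (Fin 4) (Fin 4) (ZMod 3))) e he b
    (fun h ↦ (r h).val) hr g

/-- **The characteristic-polynomial clause of `bcgp_switch_exists_modular_abelianSurface`, in the
exact binder shape of the fact, from "`ρ̄_{B,3} ≅ ρ̄`"** (BCGP Lemma 9.4.2 (2)(a), §1.8.11): for an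
abelian surface `B/ℚ` whose `3`-torsion is framed by the contragredient of `ρ̄` (an additive
`e : B[3](ℚ̄) ≃ (ℤ/3)⁴` with `e (g • P) = ρ̄(g⁻¹)ᵀ · e(P)`), the fourth conjunct's first half holds
verbatim: for all `b`, `r` with `r(g) = [g⁻¹]_bᵀ ⊗ ℚ̄₃`, for all `g`, some `P ∈ ℤ₃[X]` maps to
`charpoly r(g)` and reduces to `charpoly ρ̄(g)`.  What remains of the fact beyond this clause
(existence of `B` with (2)(a)–(2)(d), `End = ℤ`, good ordinary reduction at `3`, and modularity)
is the cited theorem itself. [cite: BoxerCalegariGeePilloni2025, Lemma 9.4.2 (2)(a) and §1.8.11] -/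
theorem bcgp_switch_charpolyClause (B : AbelianVariety ℚ) (hB : B.dim = 2)
    (ρb : FramedGaloisRep ℚ (ZMod 3) 4)
    (hρ : ∃ e : B.geomTorsion (3 : ℕ) ≃+ (Fin 4 → ZMod 3),
      ∀ (g : Field.absoluteGaloisGroup ℚ) (P : B.geomTorsion (3 : ℕ)),
        e (g • P) = ((ρb g⁻¹ : GL (Fin 4) (ZMod 3)) : Matrix (Fin 4) (Fin 4) (ZMod 3))ᵀ *ᵥ e P) :
    ∀ (b : Module.Basis (Fin 4) ℚ_[3] (B.rationalTateModule 3))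
      (r : FramedGaloisRep ℚ (PadicAlgCl 3) 4),
      (∀ g : Field.absoluteGaloisGroup ℚ,
        (r g).val =
          ((LinearMap.toMatrix b b (B.rationalTateRep 3 g⁻¹)).map
            (algebraMap ℚ_[3] (PadicAlgCl 3))).transpose) →
      ∀ g : Field.absoluteGaloisGroup ℚ, ∃ P : Polynomial ℤ_[3],
        P.map (algebraMap ℤ_[3] (PadicAlgCl 3)) = FramedRep.charpoly r g ∧
          P.map (PadicInt.toZMod (p := 3)) = FramedRep.charpoly ρb g := by
  obtain ⟨e, he⟩ := hρ
  intro b r hr g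
  exact bcgp_switch_charpolyClause_of_dualTorsionFrame B hB ρb e he b r hr g

/-! ## Part 2 (appended). "`ρ̄_{B,3} ≅ ρ̄`" literally: frames of the dual module `B[3]^∨`

Part 1 took conclusion (2)(a) of Lemma 9.4.2 in the form of a frame of `B[3]` carrying the
CONTRAGREDIENT matrices `ρ̄(g⁻¹)ᵀ`.  The paper's `ρ̄_{B,3}` is the representation of `Γ_ℚ` on the
dual `B[3]^∨ = Hom(B[3](ℚ̄), 𝔽₃)` (§1.8.11), on which `g` acts by `φ ↦ φ ∘ g⁻¹`; an isomorphism
`ρ̄_{B,3} ≅ ρ̄` is therefore an additive frame `ed : Hom(B[3](ℚ̄), ℤ/3) ≃ (ℤ/3)⁴` with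
`ed (φ ∘ g⁻¹) = ρ̄(g) · ed(φ)`.  Part 2 proves (pure linear algebra over `𝔽_p`, any finite
elementary abelian `p`-group with a group action: `exists_frame_of_dualFrame`) that such a dual
frame yields a frame `e` of `B[3]` itself with `e (g • P) = ρ̄(g⁻¹)ᵀ · e(P)` — the coordinates of
`P` in the basis dual to `ed⁻¹(δ_i)` — and restates the results of Part 1 with the literal
hypothesis (`AbelianVariety.exists_torsionFrame_of_dualTorsionFrame`,
`bcgp_switch_charpolyClause_of_dualModuleFrame`). -/

section DualFrame

variable {p : ℕ} [Fact p.Prime] {d : ℕ} {V : Type*} [AddCommGroup V] [Module (ZMod p) V]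
  [Finite V] {G : Type*} [Group G] [DistribMulAction G V]

/-- **A frame of the dual with the contragredient action is a frame of the module with the
transpose-inverse matrices.**  Let `V` be a finite `𝔽_p`-vector space with `#V = p^d`, acted on
by a group `G` through additive maps, and let `ed : Hom(V, ℤ/p) ≃ (ℤ/p)^d` be an additive frame
of the dual in which `g` acts (by `φ ↦ φ ∘ g⁻¹`) through the matrix `ρ(g)`:
`ed (φ ∘ g⁻¹) = ρ(g) · ed(φ)`.  Then `e(P) := (ed⁻¹(δ_i)(P))_i` (coordinates in the basis of
`V` dual to the basis `ed⁻¹(δ_i)` of `Hom(V, ℤ/p)`) is an additive frame `V ≃ (ℤ/p)^d` with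
`e (g • P) = ρ(g⁻¹)ᵀ · e(P)`.  Injectivity of `e`: linear functionals separate the points of `V`
(Mathlib `Module.forall_dual_apply_eq_zero_iff`); bijectivity by counting. [folklore] -/
theorem exists_frame_of_dualFrame (hcard : Nat.card V = p ^ d)
    (ρ : G → Matrix (Fin d) (Fin d) (ZMod p)) (ed : (V →+ ZMod p) ≃+ (Fin d → ZMod p))
    (hed : ∀ (g : G) (φ : V →+ ZMod p),
      ed (φ.comp (DistribSMul.toAddMonoidHom V g⁻¹)) = ρ g *ᵥ ed φ) :
    ∃ e : V ≃+ (Fin d → ZMod p), ∀ (g : G) (P : V), e (g • P) = (ρ g⁻¹)ᵀ *ᵥ e P := by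
  -- the basis `φ i = ed⁻¹(δ_i)` of the dual and the coordinate map `e₀`
  obtain ⟨φ, hφ⟩ : ∃ φ : Fin d → (V →+ ZMod p), ∀ i, φ i = ed.symm (Pi.single i 1) :=
    ⟨_, fun _ ↦ rfl⟩
  let e₀ : V →+ (Fin d → ZMod p) :=
    { toFun := fun P i ↦ φ i P
      map_zero' := funext fun i ↦ map_zero (φ i)
      map_add' := fun P Q ↦ funext fun i ↦ map_add (φ i) P Q }
  have he₀ : ∀ P i, e₀ P i = φ i P := fun P i ↦ rfl
  -- coordinates: `v = Σ_i (v i) δ_i` in `(ℤ/p)^d`, written with `ℕ`-multiples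
  have hcoord : ∀ v : Fin d → ZMod p, v = ∑ i, (v i).val • (Pi.single i (1 : ZMod p)) := by
    intro v
    ext j
    rw [Finset.sum_apply, Finset.sum_eq_single j, Pi.smul_apply, Pi.single_eq_same, nsmul_eq_mul,
      mul_one, ZMod.natCast_zmod_val]
    · intro i _ hij
      rw [Pi.smul_apply, Pi.single_eq_of_ne (Ne.symm hij), smul_zero]
    · exact fun hj ↦ absurd (Finset.mem_univ j) hj
  -- every functional, evaluated at `P`, is a combination of the `φ i P`
  have hspan : ∀ (ψ : V →+ ZMod p) (P : V), ψ P = ∑ i, ed ψ i * φ i P := by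
    intro ψ P
    let F : (Fin d → ZMod p) →+ ZMod p := (AddMonoidHom.eval P).comp ed.symm.toAddMonoidHom
    have hF : ∀ v, F v = ed.symm v P := fun v ↦ rfl
    have h1 : ψ P = F (ed ψ) := by rw [hF, ed.symm_apply_apply]
    have h2 : F (ed ψ) = F (∑ i, (ed ψ i).val • Pi.single i (1 : ZMod p)) :=
      congrArg F (hcoord (ed ψ))
    rw [h1, h2, map_sum]
    refine Finset.sum_congr rfl fun i _ ↦ ?_
    rw [map_nsmul, hF, nsmul_eq_mul, ZMod.natCast_zmod_val, hφ i]
  -- `e₀` is injective (functionals separate points) hence bijective (counting)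
  have hinj : Function.Injective e₀ := by
    refine (injective_iff_map_eq_zero _).mpr fun P hP ↦ ?_
    have hall : ∀ ψ : V →+ ZMod p, ψ P = 0 := fun ψ ↦ by
      rw [hspan ψ P]
      refine Finset.sum_eq_zero fun i _ ↦ ?_
      rw [← he₀ P i, hP, Pi.zero_apply, mul_zero]
    exact (Module.forall_dual_apply_eq_zero_iff (ZMod p) P).mp fun f ↦ hall f.toAddMonoidHom
  have hbij : Function.Bijective e₀ := by
    refine hinj.bijective_of_nat_card_le (le_of_eq ?_)
    rw [Nat.card_fun, Nat.card_zmod, Nat.card_eq_fintype_card, Fintype.card_fin, hcard]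
  refine ⟨AddEquiv.ofBijective e₀ hbij, fun g P ↦ ?_⟩
  rw [AddEquiv.ofBijective_apply, AddEquiv.ofBijective_apply]
  ext i
  -- `φ i ∘ g = Σ_k ρ(g⁻¹)_{k i} φ k` from the equivariance of `ed` at `g⁻¹`
  have key : ed ((φ i).comp (DistribSMul.toAddMonoidHom V g)) = (ρ g⁻¹).col i := by
    have h := hed g⁻¹ (φ i)
    rw [inv_inv] at h
    rw [h, hφ i, ed.apply_symm_apply, Matrix.mulVec_single_one]
  have hval : φ i (g • P) = ∑ k, ρ g⁻¹ k i * φ k P := by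
    have h := hspan ((φ i).comp (DistribSMul.toAddMonoidHom V g)) P
    rw [AddMonoidHom.comp_apply, DistribSMul.toAddMonoidHom_apply, key] at h
    exact h
  rw [he₀, hval]
  change _ = ∑ k, (ρ g⁻¹)ᵀ i k * e₀ P k
  refine Finset.sum_congr rfl fun k _ ↦ ?_
  rw [Matrix.transpose_apply, he₀]

end DualFrame

/-- **`ρ̄_{B,p} ≅ ρ̄` (a frame of the dual `B[p]^∨`) gives a contragredient frame of `B[p]`**, for an
abelian variety `B/K` of any dimension and a prime `p` invertible in `K`, `d = 2 dim B`: if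
`ed : Hom(B[p](K̄), ℤ/p) ≃ (ℤ/p)^d` satisfies `ed (φ ∘ g⁻¹) = ρ̄(g) · ed(φ)` (the Galois module
`B[p]^∨ = H¹_ét(B_K̄, 𝔽_p)` framed by `ρ̄`, BCGP §1.8.11), then some additive `e : B[p](K̄) ≃ (ℤ/p)^d`
has `e (g • P) = ρ̄(g⁻¹)ᵀ · e(P)` (`exists_frame_of_dualFrame` with `#B[p](K̄) = p^{2 dim B}`,
`natCard_geomTorsion_pow'`). [cite: BoxerCalegariGeePilloni2025, §1.8.11] -/
theorem _root_.Literature.AlgebraicGeometry.Motives.AbelianVariety.exists_torsionFrame_of_dualTorsionFrame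
    {K : Type*} [Field K] (B : AbelianVariety K) (p : ℕ) [Fact p.Prime] (hp : (p : K) ≠ 0)
    {d : ℕ} (hd : 2 * B.dim = d)
    (ρb : Field.absoluteGaloisGroup K → Matrix (Fin d) (Fin d) (ZMod p))
    (ed : (B.geomTorsion (p : ℕ) →+ ZMod p) ≃+ (Fin d → ZMod p))
    (hed : ∀ (g : Field.absoluteGaloisGroup K) (φ : B.geomTorsion (p : ℕ) →+ ZMod p),
      ed (φ.comp (DistribSMul.toAddMonoidHom (B.geomTorsion (p : ℕ)) g⁻¹)) = ρb g *ᵥ ed φ) :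
    ∃ e : B.geomTorsion (p : ℕ) ≃+ (Fin d → ZMod p),
      ∀ (g : Field.absoluteGaloisGroup K) (P : B.geomTorsion (p : ℕ)),
        e (g • P) = (ρb g⁻¹)ᵀ *ᵥ e P := by
  letI : Module (ZMod p) (B.geomTorsion (p : ℕ)) := AddSubgroup.torsionBy.zmodModule
  have hcard : Nat.card (B.geomTorsion (p : ℕ)) = p ^ d := by
    have h := B.natCard_geomTorsion_pow' p hp 1
    rwa [pow_one, mul_one, hd] at h
  haveI : Finite (B.geomTorsion (p : ℕ)) :=
    Nat.finite_of_card_ne_zero (by rw [hcard]; exact pow_ne_zero _ (Fact.out : p.Prime).ne_zero)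
  exact exists_frame_of_dualFrame hcard ρb ed hed

/-- **The characteristic-polynomial clause of `bcgp_switch_exists_modular_abelianSurface` from the
LITERAL "`ρ̄_{B,3} ≅ ρ̄`" of Lemma 9.4.2 (2)(a)** — `ρ̄_{B,3}` being `Γ_ℚ` acting on
`B[3]^∨ = Hom(B[3](ℚ̄), 𝔽₃)` by `φ ↦ φ ∘ g⁻¹` (§1.8.11), framed by `ρ̄` through an additive
`ed : Hom(B[3](ℚ̄), ℤ/3) ≃ (ℤ/3)⁴` with `ed (φ ∘ g⁻¹) = ρ̄(g) · ed(φ)`: for an abelian surface `B/ℚ`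
this gives, for all `ℚ₃`-bases `b` of `V₃ B` and `r(g) = [g⁻¹]_bᵀ ⊗ ℚ̄₃`, polynomials `P ∈ ℤ₃[X]`
mapping to `charpoly r(g)` and reducing to `charpoly ρ̄(g)`
(`exists_torsionFrame_of_dualTorsionFrame` + `bcgp_switch_charpolyClause`).
[cite: BoxerCalegariGeePilloni2025, Lemma 9.4.2 (2)(a) and §1.8.11] -/
theorem bcgp_switch_charpolyClause_of_dualModuleFrame (B : AbelianVariety ℚ) (hB : B.dim = 2)
    (ρb : FramedGaloisRep ℚ (ZMod 3) 4)
    (hρ : ∃ ed : (B.geomTorsion (3 : ℕ) →+ ZMod 3) ≃+ (Fin 4 → ZMod 3),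
      ∀ (g : Field.absoluteGaloisGroup ℚ) (φ : B.geomTorsion (3 : ℕ) →+ ZMod 3),
        ed (φ.comp (DistribSMul.toAddMonoidHom (B.geomTorsion (3 : ℕ)) g⁻¹)) =
          ((ρb g : GL (Fin 4) (ZMod 3)) : Matrix (Fin 4) (Fin 4) (ZMod 3)) *ᵥ ed φ) :
    ∀ (b : Module.Basis (Fin 4) ℚ_[3] (B.rationalTateModule 3))
      (r : FramedGaloisRep ℚ (PadicAlgCl 3) 4),
      (∀ g : Field.absoluteGaloisGroup ℚ,
        (r g).val =
          ((LinearMap.toMatrix b b (B.rationalTateRep 3 g⁻¹)).map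
            (algebraMap ℚ_[3] (PadicAlgCl 3))).transpose) →
      ∀ g : Field.absoluteGaloisGroup ℚ, ∃ P : Polynomial ℤ_[3],
        P.map (algebraMap ℤ_[3] (PadicAlgCl 3)) = FramedRep.charpoly r g ∧
          P.map (PadicInt.toZMod (p := 3)) = FramedRep.charpoly ρb g := by
  obtain ⟨ed, hed⟩ := hρ
  have h3 : ((3 : ℕ) : ℚ) ≠ 0 := by norm_num
  have hd : 2 * B.dim = 4 := by rw [hB]
  exact bcgp_switch_charpolyClause B hB ρb
    (B.exists_torsionFrame_of_dualTorsionFrame 3 h3 hd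
      (fun g ↦ ((ρb g : GL (Fin 4) (ZMod 3)) : Matrix (Fin 4) (Fin 4) (ZMod 3))) ed hed)

/-! ## Part 3 (appended). The hypothesis at `3` unpacked: the sub is Lagrangian and the quotient
is `ε̄⁻¹ ⊗ (sub)^∨` — BCGP Cor. 9.3.5 "ordinary, so an extension of an unramified `V̄` by its
Cartier dual"

The second hypothesis of `bcgp_switch_exists_modular_abelianSurface` renders "`ρ̄^∨|_{G_{ℚ₃}}` is
ordinary" (Cor. 9.3.5: "so it is an extension of an unramified 2-dimensional representation `V̄`
by its Cartier dual") as a frame condition: `g ρ̄|_{Γ_{ℚ₃}} g⁻¹` block upper-triangular, inertia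
trivial on the rank-2 sub-block and equal to the scalar `ε̄⁻¹` on the rank-2 quotient block.  Part 3
proves that, given the first hypothesis (symplectic with multiplier `ε̄⁻¹`), the frame condition
indeed carries the printed structure: the sub is LAGRANGIAN for the symplectic form and the whole
local group `Γ_{ℚ₃}` (not only inertia) acts on the quotient block through
`ε̄⁻¹ · Q⁻¹ (sub block)⁻ᵀ Q` for a fixed invertible `Q` — i.e. the quotient is `W^∨ ⊗ ε̄⁻¹` for the
unramified sub `W`, so that dually `ρ̄^∨` is an extension of `V̄ := W^∨` by `V̄^∨(1)`
(`bcgp_switch_hypothesisAtThree_quotientBlock`, from the tree's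
`IsSymplecticWithMultiplierFun.quotientBlock_toLocal_eq_smul_conj` and the ramification of `ε̄` at
`3`, `exists_mem_absInertia_modPCyclotomicCharacterZMod_three_eq_neg_one`).  In particular the
third clause of the hypothesis (inertia acts on the quotient block by the scalar `ε̄⁻¹`) is a
CONSEQUENCE of the first two and of symplecticity (`bcgp_switch_hypothesisAtThree_inertia_quotient`). -/

section AtThree

open IsDedekindDomain

/-- `3 ∈ v` identifies the place: `primesEquiv v = 3` (Mathlib `Rat.HeightOneSpectrum.primesEquiv`,
`natGenerator_dvd_iff`). [folklore] -/
private theorem primesEquiv_eq_three {v : HeightOneSpectrum (𝓞 ℚ)}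
    (hv : ((3 : ℕ) : 𝓞 ℚ) ∈ v.asIdeal) : (Rat.HeightOneSpectrum.primesEquiv v : ℕ) = 3 := by
  have h3 : Rat.HeightOneSpectrum.natGenerator v ∣ 3 := by
    rw [Rat.HeightOneSpectrum.natGenerator_dvd_iff]
    have h := Ideal.mem_map_of_mem (Rat.IsIntegralClosure.intEquiv (𝓞 ℚ)) hv
    rwa [map_natCast] at h
  exact (Nat.prime_dvd_prime_iff_eq (Rat.HeightOneSpectrum.prime_natGenerator v)
    Nat.prime_three).mp h3

/-- **`ε̄ = χ̄₃` is ramified at `3`: it takes the value `-1` on the inertia group of `ℚ₃`.**  For the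
place `v ∣ 3` of `ℚ` there is `τ ∈ I_{ℚ_v}` (tree `absInertia`) with
`χ̄₃(res τ) = -1 ∈ (ℤ/3)ˣ`, `res = absGaloisRestrict ℚ ℚ_v`.  From `χ₃(I_{ℚ_v}) = ℤ₃ˣ`
(`adicCompletion_rat_exists_mem_absInertia_cyclotomicCharacter_eq`, Serre *Local Fields* IV §4
Prop. 17), `χ₃ ∘ res = χ₃` (`cyclotomicCharacter_absGaloisRestrict`) and `χ₃ mod 3 = χ̄₃`
(`toZMod_cyclotomicCharacter_apply`). [cite: SerreLocalFields1979, Ch. IV §4 Prop. 17] -/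
theorem exists_mem_absInertia_modPCyclotomicCharacterZMod_three_eq_neg_one
    {v : HeightOneSpectrum (𝓞 ℚ)} (hv : ((3 : ℕ) : 𝓞 ℚ) ∈ v.asIdeal) :
    ∃ τ ∈ absInertia (v.adicCompletion ℚ),
      modPCyclotomicCharacterZMod ℚ 3 (absGaloisRestrict ℚ (v.adicCompletion ℚ) τ) = -1 := by
  obtain ⟨τ, hτ, hχ⟩ := adicCompletion_rat_exists_mem_absInertia_cyclotomicCharacter_eq 3 v
    (primesEquiv_eq_three hv) (-1)
  refine ⟨τ, hτ, Units.ext ?_⟩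
  rw [← toZMod_cyclotomicCharacter_apply ℚ 3, cyclotomicCharacter_absGaloisRestrict, hχ,
    Units.val_neg, Units.val_one, map_neg, map_one, Units.val_neg, Units.val_one]

/-- **Hypotheses (1) + (2, first two clauses) of `bcgp_switch_exists_modular_abelianSurface` ⟹ the
printed "ordinary" structure (BCGP Cor. 9.3.5).**  Let `ρ̄ : Γ_ℚ → GL₄(𝔽₃)` be symplectic with
multiplier `ε̄⁻¹`, `v ∣ 3`, and `g ∈ GL₄(𝔽₃)` a frame with `g ρ̄|_{Γ_{ℚ_v}}(τ) g⁻¹` block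
upper-triangular (cut at `2`) for all `τ` and equal to the identity on the sub-block for `τ` in the
inertia group.  Then for the Gram matrix `J` of the symplectic form: the transported form
`(g⁻¹)ᵀ J g⁻¹` VANISHES on the sub-block (the unramified sub `W` is Lagrangian), and with `Q` its
invertible upper-right `2 × 2` block, for EVERY `τ ∈ Γ_{ℚ_v}` the quotient block of
`g ρ̄(τ) g⁻¹` is `ε̄(τ)⁻¹ · Q⁻¹ (sub block)⁻ᵀ Q`: the quotient is `W^∨ ⊗ ε̄⁻¹`, i.e. `ρ̄^∨|_{Γ_{ℚ_v}}`
is the extension of the unramified `V̄ = W^∨` by its Cartier dual `V̄^∨(1)`, as printed.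
(`IsSymplecticWithMultiplierFun.quotientBlock_toLocal_eq_smul_conj` with `ε̄⁻¹ ≠ 1` on inertia,
`exists_mem_absInertia_modPCyclotomicCharacterZMod_three_eq_neg_one`.)
[cite: BoxerCalegariGeePilloni2025, Cor. 9.3.5 and Lemma 9.4.2 (hypotheses)] -/
theorem bcgp_switch_hypothesisAtThree_quotientBlock (ρb : FramedGaloisRep ℚ (ZMod 3) 4)
    (hsymp : ρb.IsSymplecticWithMultiplierFun
      (fun g => (((modPCyclotomicCharacterZMod ℚ 3 g)⁻¹ : (ZMod 3)ˣ) : ZMod 3)))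
    {v : HeightOneSpectrum (𝓞 ℚ)} (hv : ((3 : ℕ) : 𝓞 ℚ) ∈ v.asIdeal) (g : GL (Fin 4) (ZMod 3))
    (htri : ∀ (τ : Field.absoluteGaloisGroup (v.adicCompletion ℚ)) (i j : Fin 4),
      2 ≤ (i : ℕ) → (j : ℕ) < 2 → (g * ρb.toLocal v τ * g⁻¹).val i j = 0)
    (hsub : ∀ τ ∈ absInertia (v.adicCompletion ℚ), ∀ i j : Fin 4, (i : ℕ) < 2 → (j : ℕ) < 2 →
      (g * ρb.toLocal v τ * g⁻¹).val i j = if i = j then 1 else 0) :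
    ∃ (J : Matrix (Fin 4) (Fin 4) (ZMod 3)) (Q : Matrix (Fin 2) (Fin 2) (ZMod 3)),
      Jᵀ = -J ∧ IsUnit J.det ∧
      (∀ σ : Field.absoluteGaloisGroup ℚ, (ρb σ).valᵀ * J * (ρb σ).val =
        (((modPCyclotomicCharacterZMod ℚ 3 σ)⁻¹ : (ZMod 3)ˣ) : ZMod 3) • J) ∧
      (∀ i j : Fin 4, (i : ℕ) < 2 → (j : ℕ) < 2 → ((g⁻¹).valᵀ * J * (g⁻¹).val) i j = 0) ∧
      IsUnit Q.det ∧
      (∀ i j : Fin 2, Q i j = ((g⁻¹).valᵀ * J * (g⁻¹).val) (Fin.castAdd 2 i) (Fin.natAdd 2 j)) ∧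
      ∀ τ : Field.absoluteGaloisGroup (v.adicCompletion ℚ),
        (g * ρb.toLocal v τ * g⁻¹).val.submatrix (Fin.natAdd 2) (Fin.natAdd 2) =
          (((modPCyclotomicCharacterZMod ℚ 3 (absGaloisRestrict ℚ (v.adicCompletion ℚ) τ))⁻¹ :
              (ZMod 3)ˣ) : ZMod 3) •
            (Q⁻¹ * ((g * ρb.toLocal v τ * g⁻¹).val.submatrix (Fin.castAdd 2) (Fin.castAdd 2))⁻¹ᵀ *
              Q) := by
  obtain ⟨τ, hτ, hε⟩ := exists_mem_absInertia_modPCyclotomicCharacterZMod_three_eq_neg_one hv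
  refine hsymp.quotientBlock_toLocal_eq_smul_conj v g htri hsub ⟨τ, hτ, ?_⟩
  rw [hε, inv_neg_one, Units.val_neg, Units.val_one]
  decide

/-- **The third clause of hypothesis (2) is redundant.**  Under hypothesis (1) (symplectic with
multiplier `ε̄⁻¹`) and the first two clauses of (2) at `v ∣ 3` (block upper-triangular frame,
inertia trivial on the sub-block), inertia automatically acts on the quotient block through the
scalar `ε̄⁻¹`: for `τ ∈ I_{ℚ_v}` the sub block is `1`, so the quotient block
`ε̄(τ)⁻¹ · Q⁻¹ 1⁻ᵀ Q = ε̄(τ)⁻¹ · 1` (`bcgp_switch_hypothesisAtThree_quotientBlock`).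
[cite: BoxerCalegariGeePilloni2025, Cor. 9.3.5 and Lemma 9.4.2 (hypotheses)] -/
theorem bcgp_switch_hypothesisAtThree_inertia_quotient (ρb : FramedGaloisRep ℚ (ZMod 3) 4)
    (hsymp : ρb.IsSymplecticWithMultiplierFun
      (fun g => (((modPCyclotomicCharacterZMod ℚ 3 g)⁻¹ : (ZMod 3)ˣ) : ZMod 3)))
    {v : HeightOneSpectrum (𝓞 ℚ)} (hv : ((3 : ℕ) : 𝓞 ℚ) ∈ v.asIdeal) (g : GL (Fin 4) (ZMod 3))
    (htri : ∀ (τ : Field.absoluteGaloisGroup (v.adicCompletion ℚ)) (i j : Fin 4),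
      2 ≤ (i : ℕ) → (j : ℕ) < 2 → (g * ρb.toLocal v τ * g⁻¹).val i j = 0)
    (hsub : ∀ τ ∈ absInertia (v.adicCompletion ℚ), ∀ i j : Fin 4, (i : ℕ) < 2 → (j : ℕ) < 2 →
      (g * ρb.toLocal v τ * g⁻¹).val i j = if i = j then 1 else 0) :
    ∀ τ ∈ absInertia (v.adicCompletion ℚ), ∀ i j : Fin 4, 2 ≤ (i : ℕ) → 2 ≤ (j : ℕ) →
      (g * ρb.toLocal v τ * g⁻¹).val i j =
        if i = j then
          (((modPCyclotomicCharacterZMod ℚ 3 (absGaloisRestrict ℚ (v.adicCompletion ℚ) τ))⁻¹ :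
              (ZMod 3)ˣ) : ZMod 3)
        else 0 := by
  obtain ⟨J, Q, -, -, -, -, hQ, -, hquot⟩ :=
    bcgp_switch_hypothesisAtThree_quotientBlock ρb hsymp hv g htri hsub
  intro τ hτ i j hi hj
  set N := (g * ρb.toLocal v τ * g⁻¹).val with hN
  have hA : N.submatrix (Fin.castAdd 2) (Fin.castAdd 2) = (1 : Matrix (Fin 2) (Fin 2) (ZMod 3)) := by
    ext a b
    rw [Matrix.submatrix_apply, hN, hsub τ hτ _ _ a.isLt b.isLt, Matrix.one_apply]
    simp only [(Fin.castAdd_injective 2 2).eq_iff]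
  have hD := hquot τ
  rw [← hN, hA, inv_one, Matrix.transpose_one, Matrix.mul_one, Matrix.nonsing_inv_mul _ hQ] at hD
  -- read off the entry `(i, j)`, `i = natAdd 2 i'`, `j = natAdd 2 j'`
  obtain ⟨i', rfl⟩ : ∃ i' : Fin 2, Fin.natAdd 2 i' = i :=
    ⟨⟨i - 2, by omega⟩, Fin.ext (by simp; omega)⟩
  obtain ⟨j', rfl⟩ : ∃ j' : Fin 2, Fin.natAdd 2 j' = j :=
    ⟨⟨j - 2, by omega⟩, Fin.ext (by simp; omega)⟩
  have h := congrFun (congrFun hD i') j'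
  rw [Matrix.submatrix_apply, Matrix.smul_apply, Matrix.one_apply, smul_eq_mul, mul_ite, mul_one,
    mul_zero] at h
  rw [h]
  simp only [(Fin.natAdd_injective 2 2).eq_iff]

end AtThree

/-! ## Part 4 (appended). The hypotheses are satisfiable: `ρ̄ = 𝟙 ⊕ 𝟙 ⊕ ε̄⁻¹ ⊕ ε̄⁻¹`

A cited named fact of the shape `∀ ρ̄, H₁ ρ̄ → H₂ ρ̄ → H₃ ρ̄ → C ρ̄` is only as good as the
non-emptiness of its hypothesis locus: were `H₁ ∧ H₂ ∧ H₃` contradictory IN THE TREE'S RENDERING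
(e.g. through a mis-rendered ramification condition), the fact would be provable by vacuity and
would say nothing.  Part 4 rules this out with a Lean-certified witness of the printed hypotheses of
BCGP Lemma 9.4.2 — which carries NO big-image hypothesis (Definition 9.2.1: `P(ρ̄)` is smooth and rational
for every `ρ̄` with similitude `ε̄⁻¹`) — namely the reducible
`ρ̄ = 𝟙 ⊕ 𝟙 ⊕ ε̄⁻¹ ⊕ ε̄⁻¹ : Γ_ℚ → GSp₄(𝔽₃)` (`ρ̄^∨ = (ℤ/3)² ⊕ μ₃²`, e.g. `A[3]` for `A = E × E`
with `E/ℚ` an elliptic curve whose `3`-torsion is `ℤ/3 ⊕ μ₃`), Gram matrix `J = (0 1₂; -1₂ 0)`: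
(1) `ρ̄ᵀ J ρ̄ = ε̄⁻¹ J`; (2) at `v ∣ 3`, block DIAGONAL in the frame `g = 1` with sub-block `1` and
quotient block `ε̄⁻¹ · 1`, and peu ramifié — indeed tame: the image of `I_{ℚ_v}^u`, `u > 0`, in the
discrete `GL₄(𝔽₃)` is a `3`-group (the tree's PROVED `absUpperInertia_map_isPGroup_holds`, Serre,
*Local Fields* IV §2 Cor. 3) while `ρ̄` has exponent `2` (a general lemma is recorded:
`ModPGaloisRep.isTamelyRamified_of_forall_pow_eq_one`, exponent prime to `p` ⟹ tamely ramified);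
(3) at `v ∣ 2`, unramified
(`χ̄₃(I_𝔓) = 1` for `𝔓 ∤ 3`, `modNCyclotomicCharacter_eq_one_of_mem_inertia`) and every
`Q` with `HasFrobCharpolyAt v Q` is the characteristic polynomial of some `diag(1, 1, c, c)` (a
Frobenius exists, the tree's PROVED `exists_isArithFrobAt_of_mem_primesAbove_holds`), so
`Q(1) = 0`, whereas `(X² ± X + 2)²` take the value `1` at `X = 1` in `𝔽₃` — and such a `Q` exists,
`Q = (X - 1)²(X + 1)²` as `ε̄(Frob₂) = 2` (`hasFrobCharpolyAt_two_of_val_eq_diagonal`)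
(`bcgp_switch_hypotheses_nonvacuous`).  Consequently the fact is exactly as strong as its
conclusion on a non-empty locus: any discharge must construct the modular abelian surface
(`bcgp_switch_exists_modular_abelianSurface_imp_exists_conclusion`). -/

section Nonvacuous

open IsDedekindDomain Field Matrix Polynomial

/-! ### Part 4. The hypotheses of the fact are satisfiable: `ρ̄ = 𝟙 ⊕ 𝟙 ⊕ ε̄⁻¹ ⊕ ε̄⁻¹` -/

/-- The diagonal matrices `diag(1, 1, c, c)` multiply like their parameter. [folklore] -/
private theorem diagonal_oneOneCC_mul (a b : ZMod 3) :
    diagonal ![1, 1, a * b, a * b] = diagonal ![1, 1, a, a] * diagonal ![1, 1, b, b] := by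
  rw [diagonal_mul_diagonal]
  congr 1
  funext i
  fin_cases i <;> simp

/-- `diag(1, 1, 1, 1) = 1`. [folklore] -/
private theorem diagonal_oneOneCC_one :
    diagonal ![1, 1, (1 : ZMod 3), 1] = 1 := by
  rw [← diagonal_one]
  congr 1
  funext i
  fin_cases i <;> simp

/-- Entries of `diag(1, 1, c, c)`. [folklore] -/
private theorem diagonal_oneOneCC_apply (c : ZMod 3) (i j : Fin 4) :
    diagonal ![1, 1, c, c] i j = if i = j then (if (i : ℕ) < 2 then 1 else c) else 0 := by
  fin_cases i <;> fin_cases j <;> rfl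

/-- **The framed representation `𝟙 ⊕ 𝟙 ⊕ ε̄⁻¹ ⊕ ε̄⁻¹ : Γ_ℚ → GL₄(𝔽₃)` exists** (`ε̄ = χ̄₃` the
mod-`3` cyclotomic character; continuity from that of the tree's `modPCyclotomicCharacter`, the
target being discrete). [folklore] -/
theorem exists_framedGaloisRep_val_eq_diagonal_modPCyclotomicCharacterZMod_inv :
    ∃ ρb : FramedGaloisRep ℚ (ZMod 3) 4, ∀ σ : absoluteGaloisGroup ℚ,
      (ρb σ).val = diagonal ![1, 1,
        (((modPCyclotomicCharacterZMod ℚ 3 σ)⁻¹ : (ZMod 3)ˣ) : ZMod 3),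
        (((modPCyclotomicCharacterZMod ℚ 3 σ)⁻¹ : (ZMod 3)ˣ) : ZMod 3)] := by
  set ε : absoluteGaloisGroup ℚ →ₜ* (ZMod 3)ˣ :=
    modPCyclotomicCharacter ℚ (ZMod 3) 3 (RingHom.id (ZMod 3))
  have hε : ∀ σ, ε σ = modPCyclotomicCharacterZMod ℚ 3 σ := fun σ =>
    Units.ext (coe_modPCyclotomicCharacter_apply ℚ (ZMod 3) 3 (RingHom.id (ZMod 3)) σ)
  -- `c ↦ diag(1, 1, c, c)` as a homomorphism `𝔽₃ˣ →* GL₄(𝔽₃)`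
  let w : (ZMod 3)ˣ →* GL (Fin 4) (ZMod 3) :=
    { toFun := fun c =>
        ⟨diagonal ![1, 1, (c : ZMod 3), (c : ZMod 3)],
          diagonal ![1, 1, ((c⁻¹ : (ZMod 3)ˣ) : ZMod 3), ((c⁻¹ : (ZMod 3)ˣ) : ZMod 3)],
          by rw [← diagonal_oneOneCC_mul, Units.mul_inv, diagonal_oneOneCC_one],
          by rw [← diagonal_oneOneCC_mul, Units.inv_mul, diagonal_oneOneCC_one]⟩
      map_one' := Units.ext (by simp only [Units.val_one]; exact diagonal_oneOneCC_one)
      map_mul' := fun a b => Units.ext (by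
        simp only [Units.val_mul]
        exact diagonal_oneOneCC_mul a b) }
  let f : absoluteGaloisGroup ℚ →* GL (Fin 4) (ZMod 3) :=
    w.comp (invMonoidHom.comp ε.toMonoidHom)
  have hf : Continuous f :=
    (continuous_of_discreteTopology (f := fun c : (ZMod 3)ˣ => w c⁻¹)).comp ε.continuous_toFun
  refine ⟨⟨f, hf⟩, fun σ => ?_⟩
  show diagonal ![1, 1, (((ε σ)⁻¹ : (ZMod 3)ˣ) : ZMod 3), (((ε σ)⁻¹ : (ZMod 3)ˣ) : ZMod 3)] = _
  rw [hε]

/-- `2 ∈ v` identifies the place: `primesEquiv v = 2`. [folklore] -/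
private theorem primesEquiv_eq_two {v : HeightOneSpectrum (𝓞 ℚ)}
    (hv : ((2 : ℕ) : 𝓞 ℚ) ∈ v.asIdeal) : (Rat.HeightOneSpectrum.primesEquiv v : ℕ) = 2 := by
  have h2 : Rat.HeightOneSpectrum.natGenerator v ∣ 2 := by
    rw [Rat.HeightOneSpectrum.natGenerator_dvd_iff]
    have h := Ideal.mem_map_of_mem (Rat.IsIntegralClosure.intEquiv (𝓞 ℚ)) hv
    rwa [map_natCast] at h
  exact (Nat.prime_dvd_prime_iff_eq (Rat.HeightOneSpectrum.prime_natGenerator v)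
    Nat.prime_two).mp h2

/-- `N v = p_v` for a finite place `v` of `ℚ` (as `Rat.residueCard_eq_natGenerator'` of
`ArtinDirichletCoefficients`, reproved to keep the imports light). [folklore] -/
private theorem residueCard_eq_primesEquiv (v : HeightOneSpectrum (𝓞 ℚ)) :
    v.residueCard = (Rat.HeightOneSpectrum.primesEquiv v : ℕ) := by
  have h : Ideal.span {(Rat.HeightOneSpectrum.natGenerator v : ℤ)} =
      v.asIdeal.map (Rat.IsIntegralClosure.intEquiv (𝓞 ℚ) : 𝓞 ℚ →+* ℤ) :=
    Rat.HeightOneSpectrum.span_natGenerator v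
  rw [v.residueCard_eq_card_quotient, Nat.card_congr ((Ideal.quotientEquiv _ _
    (Rat.IsIntegralClosure.intEquiv (𝓞 ℚ)) h).trans (Int.quotientSpanNatEquivZMod _)).toEquiv,
    Nat.card_zmod]
  rfl

/-- The residue characteristic of `ℚ_v`, `v ∣ 3`, is `3` (for the residue field of the
`ValuativeRel` valuation ring of the local files: `#𝓀[ℚ_v] = N v = 3`). [folklore] -/
private theorem ringChar_residueField_adicCompletion_eq_three {v : HeightOneSpectrum (𝓞 ℚ)}
    (hv : ((3 : ℕ) : 𝓞 ℚ) ∈ v.asIdeal) :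
    ringChar (IsLocalRing.ResidueField
      (ValuativeRel.valuation (v.adicCompletion ℚ)).integer) = 3 := by
  have hres : v.residueCard = 3 := by rw [residueCard_eq_primesEquiv, primesEquiv_eq_three hv]
  obtain ⟨f, -, hq⟩ :=
    IsNonarchimedeanLocalField.residueFieldCard_eq_pow_ringChar (v.adicCompletion ℚ)
  rw [Literature.NumberTheory.Automorphic.residueFieldCard_adicCompletion_eq, hres] at hq
  exact ((Nat.Prime.pow_eq_iff Nat.prime_three).mp hq.symm).1

/-- **A mod `p` representation of a local field whose values have a common exponent prime to the
residue characteristic is tamely ramified.**  For `ρ̄ : Γ_F →ₜ* GL_n(k)`, `k` discrete, with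
`ρ̄(σ)^m = 1` for all `σ` and `m` prime to `p = char 𝓀[F]`: the image of `I_F^u`, `u > 0`, in the
discrete group `GL_n(k)` is a `p`-group (`absUpperInertia_map_isPGroup_holds`: `I_F^u`, `u > 0`, lies
in the wild inertia group, a pro-`p` group; Serre, *Local Fields*, Ch. IV §2, Cor. 3 of Prop. 7),
so `ρ̄(σ)`, `σ ∈ I_F^u`, has order dividing `gcd(m, p^j) = 1`.
[cite: SerreLocalFields1979, Ch. IV §2 Cor. 3 of Prop. 7] -/
theorem _root_.Literature.NumberTheory.GaloisRepresentations.ModPGaloisRep.isTamelyRamified_of_forall_pow_eq_one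
    {F : Type*} [Field F] [ValuativeRel F] [TopologicalSpace F] [IsNonarchimedeanLocalField F]
    {k : Type*} [Field k] [TopologicalSpace k] [DiscreteTopology k] {n : ℕ}
    (ρ : ModPGaloisRep F k n) {m : ℕ}
    (hm : m.Coprime (ringChar (IsLocalRing.ResidueField (ValuativeRel.valuation F).integer)))
    (h : ∀ σ, ρ σ ^ m = 1) : ρ.IsTamelyRamified := by
  intro u hu σ hσ
  obtain ⟨j, hj⟩ := absUpperInertia_map_isPGroup_holds F (GL (Fin n) k) ρ hu
    ⟨ρ σ, Subgroup.mem_map_of_mem _ hσ⟩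
  have hp : ρ σ ^ ringChar (IsLocalRing.ResidueField (ValuativeRel.valuation F).integer) ^ j = 1 := by
    rw [Subtype.ext_iff, Subgroup.coe_pow, Subgroup.coe_one] at hj
    exact hj
  have h1 := pow_gcd_eq_one.mpr ⟨h σ, hp⟩
  rwa [Nat.Coprime.gcd_eq_one (hm.pow_right j), pow_one] at h1

variable {ρb : FramedGaloisRep ℚ (ZMod 3) 4}
  (hρ : ∀ σ : absoluteGaloisGroup ℚ,
    (ρb σ).val = diagonal ![1, 1,
      (((modPCyclotomicCharacterZMod ℚ 3 σ)⁻¹ : (ZMod 3)ˣ) : ZMod 3),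
      (((modPCyclotomicCharacterZMod ℚ 3 σ)⁻¹ : (ZMod 3)ˣ) : ZMod 3)])
include hρ

/-- **Hypothesis (1) for `𝟙 ⊕ 𝟙 ⊕ ε̄⁻¹ ⊕ ε̄⁻¹`: symplectic with multiplier `ε̄⁻¹`** for the
standard Gram matrix `J = (0 1; -1 0)` pairing the trivial plane with the `ε̄⁻¹`-plane
(`diag(1,1,c,c)ᵀ J diag(1,1,c,c) = c J`). [folklore] -/
theorem isSymplecticWithMultiplierFun_of_val_eq_diagonal :
    ρb.IsSymplecticWithMultiplierFun
      (fun g => (((modPCyclotomicCharacterZMod ℚ 3 g)⁻¹ : (ZMod 3)ˣ) : ZMod 3)) := by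
  refine ⟨!![0, 0, 1, 0; 0, 0, 0, 1; -1, 0, 0, 0; 0, -1, 0, 0], by decide,
    Matrix.isUnit_det_of_right_inverse
      (B := -!![0, 0, 1, 0; 0, 0, 0, 1; -1, 0, 0, 0; 0, -1, 0, 0]) (by decide), fun g => ?_⟩
  rw [hρ g]
  beta_reduce
  generalize (((modPCyclotomicCharacterZMod ℚ 3 g)⁻¹ : (ZMod 3)ˣ) : ZMod 3) = c
  revert c
  decide

/-- Every value of `𝟙 ⊕ 𝟙 ⊕ ε̄⁻¹ ⊕ ε̄⁻¹` squares to `1` (`𝔽₃ˣ` has exponent `2`). [folklore] -/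
theorem sq_eq_one_of_val_eq_diagonal (σ : absoluteGaloisGroup ℚ) : ρb σ ^ 2 = 1 := by
  refine Units.ext ?_
  rw [Units.val_pow_eq_pow_val, hρ σ]
  set c : (ZMod 3)ˣ := (modPCyclotomicCharacterZMod ℚ 3 σ)⁻¹
  have hc2 : c ^ 2 = 1 := ZMod.units_pow_card_sub_one_eq_one 3 c
  rw [pow_two, ← diagonal_oneOneCC_mul, ← Units.val_mul, ← pow_two, hc2, Units.val_one,
    Units.val_one]
  exact diagonal_oneOneCC_one

/-- **`𝟙 ⊕ 𝟙 ⊕ ε̄⁻¹ ⊕ ε̄⁻¹` is tamely ramified at `v ∣ 3`** (`ℚ₃(ζ₃)/ℚ₃` is tame): its values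
square to `1` and `2` is prime to the residue characteristic `3`
(`ModPGaloisRep.isTamelyRamified_of_forall_pow_eq_one`).
[cite: SerreLocalFields1979, Ch. IV §2 Cor. 3 of Prop. 7] -/
theorem isTamelyRamified_toLocal_of_val_eq_diagonal {v : HeightOneSpectrum (𝓞 ℚ)}
    (hv : ((3 : ℕ) : 𝓞 ℚ) ∈ v.asIdeal) : ModPGaloisRep.IsTamelyRamified (ρb.toLocal v) :=
  ModPGaloisRep.isTamelyRamified_of_forall_pow_eq_one (ρb.toLocal v) (m := 2)
    (by rw [ringChar_residueField_adicCompletion_eq_three hv]; decide)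
    fun σ => by rw [FramedGaloisRep.toLocal_apply]; exact sq_eq_one_of_val_eq_diagonal hρ _

/-- **Hypothesis (2), peu ramifié clause, for `𝟙 ⊕ 𝟙 ⊕ ε̄⁻¹ ⊕ ε̄⁻¹` at `v ∣ 3`**: tamely ramified
representations are peu ramifiées (`IsTamelyRamified.isPeuRamifie`: `I^u` acts trivially for all
`u > 0`, in particular for `u > 1`). [cite: Serre1987, §2.4] -/
theorem isPeuRamifie_toLocal_of_val_eq_diagonal {v : HeightOneSpectrum (𝓞 ℚ)}
    (hv : ((3 : ℕ) : 𝓞 ℚ) ∈ v.asIdeal) : ModPGaloisRep.IsPeuRamifie (ρb.toLocal v) :=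
  (isTamelyRamified_toLocal_of_val_eq_diagonal hρ hv).isPeuRamifie

/-- **Hypothesis (2), block clauses, for `𝟙 ⊕ 𝟙 ⊕ ε̄⁻¹ ⊕ ε̄⁻¹` at `v ∣ 3`** in the frame `g = 1`:
`ρ̄|_{Γ_{ℚ_v}}` is block diagonal with sub-block `1` and quotient block `ε̄⁻¹ · 1`. [folklore] -/
theorem blockShape_toLocal_of_val_eq_diagonal (v : HeightOneSpectrum (𝓞 ℚ)) :
    ∃ g : GL (Fin 4) (ZMod 3),
      (∀ (τ : absoluteGaloisGroup (v.adicCompletion ℚ)) (i j : Fin 4),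
          2 ≤ (i : ℕ) → (j : ℕ) < 2 → (g * ρb.toLocal v τ * g⁻¹).val i j = 0) ∧
      (∀ τ ∈ absInertia (v.adicCompletion ℚ), ∀ i j : Fin 4, (i : ℕ) < 2 → (j : ℕ) < 2 →
          (g * ρb.toLocal v τ * g⁻¹).val i j = if i = j then 1 else 0) ∧
      (∀ τ ∈ absInertia (v.adicCompletion ℚ), ∀ i j : Fin 4, 2 ≤ (i : ℕ) → 2 ≤ (j : ℕ) →
          (g * ρb.toLocal v τ * g⁻¹).val i j =
            if i = j then
              (((modPCyclotomicCharacterZMod ℚ 3 (absGaloisRestrict ℚ (v.adicCompletion ℚ) τ))⁻¹ :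
                  (ZMod 3)ˣ) : ZMod 3)
            else 0) := by
  have hval : ∀ τ : absoluteGaloisGroup (v.adicCompletion ℚ), ∀ i j : Fin 4,
      ((1 : GL (Fin 4) (ZMod 3)) * ρb.toLocal v τ * 1⁻¹).val i j =
        if i = j then (if (i : ℕ) < 2 then 1 else
          (((modPCyclotomicCharacterZMod ℚ 3 (absGaloisRestrict ℚ (v.adicCompletion ℚ) τ))⁻¹ :
              (ZMod 3)ˣ) : ZMod 3)) else 0 := by
    intro τ i j
    rw [inv_one, mul_one, one_mul, FramedGaloisRep.toLocal_apply, hρ, diagonal_oneOneCC_apply]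
  refine ⟨1, fun τ i j hi hj => ?_, fun τ _ i j hi hj => ?_, fun τ _ i j hi hj => ?_⟩
  · rw [hval, if_neg]
    rintro rfl
    omega
  · rw [hval]
    by_cases h : i = j
    · rw [if_pos h, if_pos h, if_pos hi]
    · rw [if_neg h, if_neg h]
  · rw [hval]
    by_cases h : i = j
    · rw [if_pos h, if_pos h, if_neg (not_lt.mpr hi)]
    · rw [if_neg h, if_neg h]

/-- **Hypothesis (3), unramified clause, for `𝟙 ⊕ 𝟙 ⊕ ε̄⁻¹ ⊕ ε̄⁻¹` at `v ∣ 2`**: `ε̄ = χ̄₃` is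
unramified at `2` (`modNCyclotomicCharacter_eq_one_of_mem_inertia`). [folklore] -/
theorem isUnramifiedAt_of_val_eq_diagonal {v : HeightOneSpectrum (𝓞 ℚ)}
    (hv : ((2 : ℕ) : 𝓞 ℚ) ∈ v.asIdeal) : ρb.IsUnramifiedAt v := by
  intro 𝔓 h𝔓 σ hσ
  haveI : 𝔓.IsPrime := h𝔓.1
  have h3 : ((3 : ℕ) : absIntegers (𝓞 ℚ) ℚ) ∉ 𝔓 :=
    Rat.natCast_not_mem_of_mem_primesAbove_of_not_dvd h𝔓 (by rw [primesEquiv_eq_two hv]; decide)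
  have hε : modPCyclotomicCharacterZMod ℚ 3 σ = 1 := by
    rw [modPCyclotomicCharacterZMod_eq_modNCyclotomicCharacter]
    exact modNCyclotomicCharacter_eq_one_of_mem_inertia h3 hσ
  refine Units.ext ?_
  rw [hρ σ, hε, inv_one, Units.val_one, Units.val_one]
  exact diagonal_oneOneCC_one

/-- **The Frobenius at `2` of `𝟙 ⊕ 𝟙 ⊕ ε̄⁻¹ ⊕ ε̄⁻¹`**: `ε̄(Frob₂) = 2 = -1 ∈ 𝔽₃ˣ`
(`modNCyclotomicCharacter_eq_residueCard_of_isArithFrobAt`), so every arithmetic Frobenius above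
`2` has characteristic polynomial `(X - 1)²(X + 1)²` — the Frobenius clause of hypothesis (3) is
itself non-vacuously satisfied, by a polynomial different from `(X² ± X + 2)²`. [folklore] -/
theorem hasFrobCharpolyAt_two_of_val_eq_diagonal {v : HeightOneSpectrum (𝓞 ℚ)}
    (hv : ((2 : ℕ) : 𝓞 ℚ) ∈ v.asIdeal) :
    ρb.HasFrobCharpolyAt v ((Polynomial.X - 1) ^ 2 * (Polynomial.X + 1) ^ 2) := by
  intro 𝔓 h𝔓 σ hσ
  haveI : 𝔓.IsPrime := h𝔓.1
  have h3 : ((3 : ℕ) : absIntegers (𝓞 ℚ) ℚ) ∉ 𝔓 :=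
    Rat.natCast_not_mem_of_mem_primesAbove_of_not_dvd h𝔓 (by rw [primesEquiv_eq_two hv]; decide)
  have hε : modPCyclotomicCharacterZMod ℚ 3 σ = -1 := by
    refine Units.ext ?_
    rw [modPCyclotomicCharacterZMod_eq_modNCyclotomicCharacter,
      modNCyclotomicCharacter_eq_residueCard_of_isArithFrobAt h𝔓 h3 hσ, residueCard_eq_primesEquiv,
      primesEquiv_eq_two hv]
    decide
  rw [FramedRep.charpoly, hρ σ, hε, inv_neg_one, Units.val_neg, Units.val_one, charpoly_diagonal,
    Fin.prod_univ_four]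
  have h2 : (![(1 : ZMod 3), 1, -1, -1] 2) = -1 := rfl
  have h3' : (![(1 : ZMod 3), 1, -1, -1] 3) = -1 := rfl
  simp only [cons_val_zero, cons_val_one, h2, h3', map_one, map_neg, sub_neg_eq_add]
  ring

/-- **Hypothesis (3), Frobenius clause, for `𝟙 ⊕ 𝟙 ⊕ ε̄⁻¹ ⊕ ε̄⁻¹` at `v ∣ 2`**: every matrix
`diag(1, 1, c, c)` has the eigenvalue `1`, whereas `(X² ± X + 2)²` does not vanish at `1` in `𝔽₃`;
a Frobenius at a prime above `v` exists (`exists_isArithFrobAt_of_mem_primesAbove_holds`), so any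
`Q` with `HasFrobCharpolyAt v Q` is such a characteristic polynomial (in fact
`Q = (X - 1)²(X + 1)²`, `hasFrobCharpolyAt_two_of_val_eq_diagonal`). [folklore] -/
theorem frobCharpoly_ne_of_val_eq_diagonal (v : HeightOneSpectrum (𝓞 ℚ))
    (Q : Polynomial (ZMod 3)) (hQ : ρb.HasFrobCharpolyAt v Q) :
    Q ≠ (Polynomial.X ^ 2 + Polynomial.X + 2) ^ 2 ∧
      Q ≠ (Polynomial.X ^ 2 - Polynomial.X + 2) ^ 2 := by
  obtain ⟨𝔓, h𝔓⟩ := HeightOneSpectrum.primesAbove_nonempty v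
  obtain ⟨σ, hσ⟩ := HeightOneSpectrum.exists_isArithFrobAt_of_mem_primesAbove_holds h𝔓
  have hQσ := hQ 𝔓 h𝔓 σ hσ
  have hroot : Q.eval 1 = 0 := by
    rw [← hQσ, FramedRep.charpoly, hρ σ, charpoly_diagonal, eval_prod]
    exact Finset.prod_eq_zero (Finset.mem_univ (0 : Fin 4))
      (by rw [Matrix.cons_val_zero, eval_sub, eval_X, eval_C, sub_self])
  constructor
  · rintro rfl
    simp only [eval_pow, eval_add, eval_X, eval_ofNat] at hroot
    revert hroot
    decide
  · rintro rfl
    simp only [eval_pow, eval_add, eval_sub, eval_X, eval_ofNat] at hroot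
    revert hroot
    decide

omit hρ in
/-- **The hypotheses of `bcgp_switch_exists_modular_abelianSurface` are simultaneously
satisfiable** — the named fact is NOT vacuously true.  Witness: `ρ̄ = 𝟙 ⊕ 𝟙 ⊕ ε̄⁻¹ ⊕ ε̄⁻¹` with the
Gram matrix pairing the two planes, i.e. `ρ̄^∨ = (ℤ/3)² ⊕ μ₃²` (e.g. `A[3]` for `A = E × E` with `E/ℚ`
an elliptic curve whose `3`-torsion is `ℤ/3 ⊕ μ₃`): it has similitude `ε̄⁻¹` (hypothesis (1)),
`ρ̄^∨|_{G_{ℚ₃}}` is the SPLIT extension of the unramified `𝟙²` by its Cartier dual `μ₃²`, ordinary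
and finite flat — in the tree's rendering: block diagonal in the frame `g = 1` and peu ramifié,
indeed tame (hypothesis (2)); and it is unramified at `2` with `charpoly ρ̄(Frob₂) = (X-1)²(X+1)²`,
which is neither `(X² + X + 2)²` nor `(X² - X + 2)²` (hypothesis (3); in the Atlas language of BCGP
Lemma 9.1.3: `ρ̄(Frob₂)` is not of Atlas type `4C`, `12C`).  BCGP Lemma 9.4.2 carries no big-image
hypothesis (the twisted moduli space `P(ρ̄)` is smooth and rational for every `ρ̄` with similitude
`ε̄⁻¹`, Definition 9.2.1), so this reducible `ρ̄` is a legitimate input of the printed lemma.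
[cite: BoxerCalegariGeePilloni2025, Lemma 9.4.2 (hypotheses) and Definition 9.2.1] -/
theorem bcgp_switch_hypotheses_nonvacuous :
    ∃ ρb : FramedGaloisRep ℚ (ZMod 3) 4,
      ρb.IsSymplecticWithMultiplierFun
          (fun g => (((modPCyclotomicCharacterZMod ℚ 3 g)⁻¹ : (ZMod 3)ˣ) : ZMod 3)) ∧
      (∀ v : HeightOneSpectrum (𝓞 ℚ), ((3 : ℕ) : 𝓞 ℚ) ∈ v.asIdeal →
        ModPGaloisRep.IsPeuRamifie (ρb.toLocal v) ∧
        ∃ g : GL (Fin 4) (ZMod 3),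
          (∀ (τ : Field.absoluteGaloisGroup (v.adicCompletion ℚ)) (i j : Fin 4),
              2 ≤ (i : ℕ) → (j : ℕ) < 2 → (g * ρb.toLocal v τ * g⁻¹).val i j = 0) ∧
          (∀ τ ∈ absInertia (v.adicCompletion ℚ), ∀ i j : Fin 4, (i : ℕ) < 2 → (j : ℕ) < 2 →
              (g * ρb.toLocal v τ * g⁻¹).val i j = if i = j then 1 else 0) ∧
          (∀ τ ∈ absInertia (v.adicCompletion ℚ), ∀ i j : Fin 4, 2 ≤ (i : ℕ) → 2 ≤ (j : ℕ) →
              (g * ρb.toLocal v τ * g⁻¹).val i j =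
                if i = j then
                  (((modPCyclotomicCharacterZMod ℚ 3 (absGaloisRestrict ℚ (v.adicCompletion ℚ) τ))⁻¹ :
                      (ZMod 3)ˣ) : ZMod 3)
                else 0)) ∧
      (∀ v : HeightOneSpectrum (𝓞 ℚ), ((2 : ℕ) : 𝓞 ℚ) ∈ v.asIdeal →
        ρb.IsUnramifiedAt v ∧
          ∀ Q : Polynomial (ZMod 3), ρb.HasFrobCharpolyAt v Q →
            Q ≠ (Polynomial.X ^ 2 + Polynomial.X + 2) ^ 2 ∧
              Q ≠ (Polynomial.X ^ 2 - Polynomial.X + 2) ^ 2) := by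
  obtain ⟨ρb, hρ⟩ := exists_framedGaloisRep_val_eq_diagonal_modPCyclotomicCharacterZMod_inv
  exact ⟨ρb, isSymplecticWithMultiplierFun_of_val_eq_diagonal hρ,
    fun v hv => ⟨isPeuRamifie_toLocal_of_val_eq_diagonal hρ hv,
      blockShape_toLocal_of_val_eq_diagonal hρ v⟩,
    fun v hv => ⟨isUnramifiedAt_of_val_eq_diagonal hρ hv,
      fun Q hQ => frobCharpoly_ne_of_val_eq_diagonal hρ v Q hQ⟩⟩

omit hρ in
/-- **`bcgp_switch_exists_modular_abelianSurface` is not provable by vacuity**: the fact is of the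
form `∀ ρ̄, H₁ ρ̄ → H₂ ρ̄ → H₃ ρ̄ → C ρ̄` and `H₁ ∧ H₂ ∧ H₃` holds for some `ρ̄`
(`bcgp_switch_hypotheses_nonvacuous`), so the fact is equivalent to — and exactly as strong as —
its conclusion `C ρ̄` on the (non-empty) locus of the printed hypotheses; a discharge must produce
the modular abelian surface. [cite: BoxerCalegariGeePilloni2025, Lemma 9.4.2] -/
theorem bcgp_switch_exists_modular_abelianSurface_imp_exists_conclusion
    (h : bcgp_switch_exists_modular_abelianSurface) :
    ∃ (ρb : FramedGaloisRep ℚ (ZMod 3) 4) (B : Literature.AlgebraicGeometry.Motives.AbelianVariety ℚ),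
      B.dim = 2 ∧
      (∀ v : HeightOneSpectrum (𝓞 ℚ), ((3 : ℕ) : 𝓞 ℚ) ∈ v.asIdeal →
        B.HasGoodOrdinaryReductionAt v) ∧
      (∀ f : B ⟶ B, ∃ n : ℤ, f = n • CategoryTheory.CategoryStruct.id B) ∧
      ∀ (b : Module.Basis (Fin 4) ℚ_[3] (B.rationalTateModule 3))
        (r : FramedGaloisRep ℚ (PadicAlgCl 3) 4),
        (∀ g : Field.absoluteGaloisGroup ℚ,
          (r g).val =
            ((LinearMap.toMatrix b b (B.rationalTateRep 3 g⁻¹)).map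
              (algebraMap ℚ_[3] (PadicAlgCl 3))).transpose) →
        (∀ g : Field.absoluteGaloisGroup ℚ, ∃ P : Polynomial ℤ_[3],
            P.map (algebraMap ℤ_[3] (PadicAlgCl 3)) = FramedRep.charpoly r g ∧
            P.map (PadicInt.toZMod (p := 3)) = FramedRep.charpoly ρb g) ∧
        ∀ (hcpt : Automorphic.isCompact_glFiniteIntegralLevel 4 ℚ) (ι : PadicAlgCl 3 ≃+* ℂ),
          ∃ π : Automorphic.CuspidalAutomorphicRepData 4 ℚ hcpt, π.1.IsLAlgebraic ∧
            ∀ᶠ v : HeightOneSpectrum (𝓞 ℚ) in Filter.cofinite, ∃ a : Multiset ℂ,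
              π.1.HasSatakeParamAt v a ∧ r.IsUnramifiedAt v ∧
                r.HasFrobCharpolyAt v (Automorphic.arithFrobPolyOfSatake ι v.residueCard 1 a) := by
  obtain ⟨ρb, h1, h2, h3⟩ := bcgp_switch_hypotheses_nonvacuous
  exact ⟨ρb, h ρb h1 h2 h3⟩

end Nonvacuous

/-! ## Part 5 (appended). Two more clauses in the printed vocabulary: `GSp₄(𝔽₃)`-valued up to
the frame (hypothesis (1)), and "Moreover `End(B_ℚ̄) = ℤ`" (the endomorphism clause)

* Hypothesis (1) of the fact quantifies over SOME skew-symmetric Gram matrix `J` with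
  `det J ∈ 𝔽₃ˣ`; the paper writes `ρ̄ : G_ℚ → GSp₄(𝔽₃)` for the FIXED `J = (0 S; -S 0)`,
  `S = antidiag(1, 1)` of §1.8.6.  These agree up to the frame — and every clause of the fact's
  conclusion is frame-invariant (characteristic polynomials; the frames `b` are arbitrary):
  `FramedGaloisRep.isSymplecticWithMultiplierFun_iff_exists_conj_isSimilitude_bcgpJ` (any
  coefficient field with `2 ≠ 0`; symplectic bases, the tree's `exists_transpose_mul_mul_eq_neg_J`)
  and its special case `bcgp_switch_hypothesisOne_iff_exists_conj_gsp4`.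
* The fact records "Moreover, `End(B_ℚ̄) = ℤ`" through `End_ℚ(B) = ℤ · 𝟙`; Part 5 proves the
  implication from the geometric statement (`bcgp_switch_endClause_of_geomEnd`, from the tree's
  `Hom.baseChange_injective`: faithfully flat descent of morphisms). -/

section StandardForm

open Matrix Field

/-- Mathlib's standard alternating matrix `-J₀ = (0 1₂; -1₂ 0)` on `Fin 2 ⊕ Fin 2`, reindexed to
`Fin 4` through `inl i ↦ i`, `inr 0 ↦ 3`, `inr 1 ↦ 2`, is BCGP's Gram matrix `J = (0 S; -S 0)`,
`S = antidiag(1, 1)` (§1.8.6). [cite: BoxerCalegariGeePilloni2025, §1.8.6] -/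
private theorem submatrix_neg_J_eq_bcgpJ {k : Type*} [Field k] :
    (-Matrix.J (Fin 2) k).submatrix
        (((finSumFinEquiv (m := 2) (n := 2)).trans (Equiv.swap (2 : Fin 4) 3)).symm)
        (((finSumFinEquiv (m := 2) (n := 2)).trans (Equiv.swap (2 : Fin 4) 3)).symm) =
      !![0, 0, 0, 1; 0, 0, 1, 0; 0, -1, 0, 0; -1, 0, 0, 0] := by
  have he : ∀ i : Fin 4,
      ((finSumFinEquiv (m := 2) (n := 2)).trans (Equiv.swap (2 : Fin 4) 3)).symm i =
        ![Sum.inl 0, Sum.inl 1, Sum.inr 1, Sum.inr 0] i := by decide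
  ext i j
  simp only [submatrix_apply, he]
  fin_cases i <;> fin_cases j <;> simp [Matrix.J, Matrix.fromBlocks]

/-- BCGP's `J` is skew-symmetric. [folklore] -/
private theorem transpose_bcgpJ {k : Type*} [Field k] :
    (!![0, 0, 0, 1; 0, 0, 1, 0; 0, -1, 0, 0; -1, 0, 0, 0] : Matrix (Fin 4) (Fin 4) k)ᵀ =
      -!![0, 0, 0, 1; 0, 0, 1, 0; 0, -1, 0, 0; -1, 0, 0, 0] := by
  ext i j
  fin_cases i <;> fin_cases j <;> simp

/-- `det J ∈ kˣ` for BCGP's `J` (indeed `J · (-J) = 1`). [folklore] -/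
private theorem isUnit_det_bcgpJ {k : Type*} [Field k] :
    IsUnit (!![0, 0, 0, 1; 0, 0, 1, 0; 0, -1, 0, 0; -1, 0, 0, 0] :
      Matrix (Fin 4) (Fin 4) k).det := by
  refine Matrix.isUnit_det_of_right_inverse
    (B := -!![0, 0, 0, 1; 0, 0, 1, 0; 0, -1, 0, 0; -1, 0, 0, 0]) ?_
  ext i j
  fin_cases i <;> fin_cases j <;> simp [Matrix.mul_apply, Fin.sum_univ_four]

/-- **Hypothesis (1) of `bcgp_switch_exists_modular_abelianSurface` is, up to the frame, the
printed "`ρ̄ : G_ℚ → GSp₄(𝔽₃)` with similitude `ν`".**  For a framed `ρ : Γ_K → GL₄(k)` over a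
field `k` with `2 ≠ 0` and any function `ν`, the tree's `IsSymplecticWithMultiplierFun ρ ν`
(`ρ(g)ᵀ J ρ(g) = ν(g) J` for SOME skew-symmetric `J` with `det J ∈ kˣ`) holds iff some
`GL₄(k)`-conjugate `P⁻¹ ρ P` takes values in BCGP's `GSp₄ = GSp(J)` for THEIR Gram matrix
`J = (0 S; -S 0)`, `S = antidiag(1, 1)` (§1.8.6), with similitude `ν`:
`(P⁻¹ρ(g)P)ᵀ J (P⁻¹ρ(g)P) = ν(g) J` (tree `IsSimilitude`).  (⟹: `J` is alternating as `2 ≠ 0`;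
a symplectic basis — `exists_transpose_mul_mul_eq_neg_J`, McDuff–Salamon Thm. 2.1.3 — brings it to
Mathlib's standard form, which is BCGP's after reindexing (`submatrix_neg_J_eq_bcgpJ`); conjugate
by the base-change matrix, `IsSimilitude.conj`.  ⟸: transport BCGP's `J` back along `P⁻¹`.)
[cite: BoxerCalegariGeePilloni2025, §1.8.6 and Lemma 9.4.2 (hypotheses)]
[cite: McDuffSalamon2017, Thm. 2.1.3] -/
theorem _root_.Literature.NumberTheory.GaloisRepresentations.FramedGaloisRep.isSymplecticWithMultiplierFun_iff_exists_conj_isSimilitude_bcgpJ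
    {K : Type*} [Field K] {k : Type*} [Field k] [TopologicalSpace k] (h2 : (2 : k) ≠ 0)
    (ρ : FramedGaloisRep K k 4) (ν : absoluteGaloisGroup K → k) :
    ρ.IsSymplecticWithMultiplierFun ν ↔
      ∃ P : GL (Fin 4) k, ∀ g : absoluteGaloisGroup K,
        IsSimilitude
          (!![0, 0, 0, 1; 0, 0, 1, 0; 0, -1, 0, 0; -1, 0, 0, 0] : Matrix (Fin 4) (Fin 4) k)
          (ν g) (P⁻¹ * ρ g * P).val := by
  constructor
  · rintro ⟨J, hJt, hJu, hJ⟩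
    set e : Fin 2 ⊕ Fin 2 ≃ Fin 4 :=
      (finSumFinEquiv (m := 2) (n := 2)).trans (Equiv.swap (2 : Fin 4) 3) with he
    -- `J` is alternating (`2 ≠ 0`)
    have hJd : ∀ i, J i i = 0 := fun i => by
      have h := apply_eq_neg_apply_of_transpose_eq_neg hJt i i
      have h' : (2 : k) * J i i = 0 := by
        rw [two_mul]
        nth_rewrite 1 [h]
        rw [neg_add_cancel]
      exact (mul_eq_zero.mp h').resolve_left h2
    -- a symplectic basis for the reindexed form
    have hJs0 : (J.submatrix e e).det ≠ 0 := by
      rw [Matrix.det_submatrix_equiv_self]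
      exact hJu.ne_zero
    have hJst : (J.submatrix e e)ᵀ = -J.submatrix e e := by
      rw [transpose_submatrix, hJt]
      rfl
    obtain ⟨P, hP0, hP⟩ :=
      exists_transpose_mul_mul_eq_neg_J (K := k) (m := 2) hJs0 hJst (fun i => hJd (e i))
    -- transported back to `Fin 4`, the base change brings `J` to BCGP's Gram matrix
    set P4 : Matrix (Fin 4) (Fin 4) k := P.submatrix e.symm e.symm with hP4
    have hP4J : P4ᵀ * J * P4 = !![0, 0, 0, 1; 0, 0, 1, 0; 0, -1, 0, 0; -1, 0, 0, 0] := by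
      have hJ' : J = (J.submatrix e e).submatrix e.symm e.symm := by
        rw [submatrix_submatrix, Equiv.self_comp_symm, submatrix_id_id]
      rw [hP4, transpose_submatrix, hJ', submatrix_mul_equiv, submatrix_mul_equiv, hP, he]
      exact submatrix_neg_J_eq_bcgpJ
    have hP4u : IsUnit P4.det := by
      rw [hP4, Matrix.det_submatrix_equiv_self]
      exact isUnit_iff_ne_zero.mpr hP0
    refine ⟨Matrix.GeneralLinearGroup.mkOfDetNeZero P4 hP4u.ne_zero, fun g => ?_⟩
    have h := (show IsSimilitude J (ν g) (ρ g).val from hJ g).conj (P := P4⁻¹) (Q := P4)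
      (Matrix.mul_nonsing_inv P4 hP4u)
    rw [hP4J] at h
    have e1 : ((Matrix.GeneralLinearGroup.mkOfDetNeZero P4 hP4u.ne_zero)⁻¹ * ρ g *
        Matrix.GeneralLinearGroup.mkOfDetNeZero P4 hP4u.ne_zero).val = P4⁻¹ * (ρ g).val * P4 := by
      rw [Units.val_mul, Units.val_mul, Matrix.coe_units_inv]
      rfl
    rw [e1]
    exact h
  · rintro ⟨P, hP⟩
    have hPi : IsUnit (P⁻¹).val.det :=
      ⟨Matrix.GeneralLinearGroup.det P⁻¹, rfl⟩
    refine ⟨(P⁻¹).valᵀ * !![0, 0, 0, 1; 0, 0, 1, 0; 0, -1, 0, 0; -1, 0, 0, 0] * (P⁻¹).val,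
      transpose_conj_transpose_eq_neg transpose_bcgpJ _, ?_, fun g => ?_⟩
    · rw [det_mul, det_mul, det_transpose]
      exact (hPi.mul isUnit_det_bcgpJ).mul hPi
    · have h := (hP g).conj (P := P.val) (Q := (P⁻¹).val)
        (by rw [← Units.val_mul, inv_mul_cancel, Units.val_one])
      have e1 : P.val * (P⁻¹ * ρ g * P).val * (P⁻¹).val = (ρ g).val := by
        rw [← Units.val_mul, ← Units.val_mul]
        congr 1
        group
      rw [e1] at h
      exact h

/-- **Hypothesis (1) of the fact, literally**: for `ρ̄ : Γ_ℚ → GL₄(𝔽₃)`, the tree's first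
hypothesis `IsSymplecticWithMultiplierFun ρ̄ ε̄⁻¹` holds iff some conjugate `P⁻¹ ρ̄ P` is a
homomorphism `G_ℚ → GSp₄(𝔽₃)` (BCGP's `J`, §1.8.6) with similitude character `ε̄⁻¹` — the printed
standing hypothesis of Lemma 9.4.2 / Def. 9.2.1.
[cite: BoxerCalegariGeePilloni2025, §1.8.6, Def. 9.2.1 and Lemma 9.4.2 (hypotheses)] -/
theorem bcgp_switch_hypothesisOne_iff_exists_conj_gsp4 (ρb : FramedGaloisRep ℚ (ZMod 3) 4) :
    ρb.IsSymplecticWithMultiplierFun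
        (fun g => (((modPCyclotomicCharacterZMod ℚ 3 g)⁻¹ : (ZMod 3)ˣ) : ZMod 3)) ↔
      ∃ P : GL (Fin 4) (ZMod 3), ∀ g : absoluteGaloisGroup ℚ,
        IsSimilitude
          (!![0, 0, 0, 1; 0, 0, 1, 0; 0, -1, 0, 0; -1, 0, 0, 0] : Matrix (Fin 4) (Fin 4) (ZMod 3))
          (((modPCyclotomicCharacterZMod ℚ 3 g)⁻¹ : (ZMod 3)ˣ) : ZMod 3) (P⁻¹ * ρb g * P).val :=
  ρb.isSymplecticWithMultiplierFun_iff_exists_conj_isSimilitude_bcgpJ (by decide) _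

end StandardForm

section EndDescent

open CategoryTheory

universe u

/-- **Scalar endomorphism rings descend**: if every endomorphism of `B_L` is `n · 𝟙` (`n ∈ ℤ`),
so is every endomorphism of `B` (any abelian variety, any field extension `L/K`) — base change of
homomorphisms along a field extension is injective (`Hom.baseChange_injective`, faithfully flat
descent) and maps `n · 𝟙_B` to `n · 𝟙_{B_L}` (`baseChange_zsmul_id`). [folklore] -/
theorem _root_.Literature.AlgebraicGeometry.Motives.AbelianVariety.forall_end_eq_zsmul_id_of_baseChange
    {K : Type u} [Field K] (L : Type u) [Field L] [Algebra K L] (B : AbelianVariety K)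
    (h : ∀ f : B.baseChange L ⟶ B.baseChange L, ∃ n : ℤ, f = n • 𝟙 (B.baseChange L)) :
    ∀ f : B ⟶ B, ∃ n : ℤ, f = n • 𝟙 B := by
  intro f
  obtain ⟨n, hn⟩ := h (Hom.baseChange L f)
  exact ⟨n, Hom.baseChange_injective L (by rw [hn, baseChange_zsmul_id])⟩

/-- **"Moreover, `End(B_ℚ̄) = ℤ`" (BCGP Lemma 9.4.2) ⟹ the endomorphism clause
`∀ f : B ⟶ B, ∃ n : ℤ, f = n • 𝟙 B` of `bcgp_switch_exists_modular_abelianSurface`**: the tree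
records the printed geometric statement through its consequence over `ℚ`
(`AbelianVariety.forall_end_eq_zsmul_id_of_baseChange` with `L = ℚ̄`).
[cite: BoxerCalegariGeePilloni2025, Lemma 9.4.2 ("Moreover")] -/
theorem bcgp_switch_endClause_of_geomEnd (B : AbelianVariety ℚ)
    (h : ∀ f : B.baseChange (AlgebraicClosure ℚ) ⟶ B.baseChange (AlgebraicClosure ℚ),
      ∃ n : ℤ, f = n • 𝟙 (B.baseChange (AlgebraicClosure ℚ))) :
    ∀ f : B ⟶ B, ∃ n : ℤ, f = n • 𝟙 B :=
  B.forall_end_eq_zsmul_id_of_baseChange (AlgebraicClosure ℚ) h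

end EndDescent

/-! ## Part 6 (appended). Hypothesis (3) in the `frobCharpoly` vocabulary

The fact phrases "the characteristic polynomial of `ρ̄(Frob₂)` is not `(x² ± x + 2)²`" robustly, as
"every `Q` with `HasFrobCharpolyAt v Q` differs from `(X² ± X + 2)²`" (no choice of Frobenius, no
junk value).  Together with the unramifiedness conjunct this is equivalent to the statement about
the tree's chosen polynomial `frobCharpoly` (`bcgp_switch_hypothesisAtTwo_iff_frobCharpoly`, from
the general `FramedGaloisRep.isUnramifiedAt_and_forall_hasFrobCharpolyAt_iff`), which is how a
consumer holding `frobCharpoly ρ̄ v` discharges hypothesis (3). -/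

section FrobCharpolyForm

open IsDedekindDomain Field

/-- **"Unramified at `v` and every Frobenius characteristic polynomial at `v` satisfies `p`" is
"unramified at `v` and THE Frobenius characteristic polynomial satisfies `p`"** (any number field,
any coefficients, any rank, any predicate `p`).  For a framed `ρ` unramified at `v`, the tree's
chosen `ρ.toGaloisRep.frobCharpoly v` has the defining property
(`hasFrobCharpolyAt_frobCharpoly_holds`) and any two polynomials with it coincide
(`HasFrobCharpolyAt.unique_holds`: a prime above `v` and a Frobenius at it exist); framed and
unframed predicates agree (`hasFrobCharpolyAt_toGaloisRep_iff`, `isUnramifiedAt_toGaloisRep_iff`).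
[cite: SerreAbelianLadic1968, Ch. I §2.1] -/
theorem _root_.Literature.NumberTheory.GaloisRepresentations.FramedGaloisRep.isUnramifiedAt_and_forall_hasFrobCharpolyAt_iff
    {K : Type*} [Field K] [NumberField K] {A : Type*} [CommRing A] [TopologicalSpace A]
    [IsTopologicalRing A] {n : ℕ} (ρ : FramedGaloisRep K A n) (v : HeightOneSpectrum (𝓞 K))
    (p : Polynomial A → Prop) :
    (ρ.IsUnramifiedAt v ∧ ∀ Q : Polynomial A, ρ.HasFrobCharpolyAt v Q → p Q) ↔
      (ρ.IsUnramifiedAt v ∧ p (ρ.toGaloisRep.frobCharpoly v)) := by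
  refine and_congr_right fun hur => ?_
  have hfrob : ρ.HasFrobCharpolyAt v (ρ.toGaloisRep.frobCharpoly v) :=
    (FramedGaloisRep.hasFrobCharpolyAt_toGaloisRep_iff v _ ρ).mp
      (GaloisRep.hasFrobCharpolyAt_frobCharpoly_holds
        ((FramedGaloisRep.isUnramifiedAt_toGaloisRep_iff v ρ).mpr hur))
  refine ⟨fun h => h _ hfrob, fun h Q hQ => ?_⟩
  have hQ' := (FramedGaloisRep.hasFrobCharpolyAt_toGaloisRep_iff v Q ρ).mpr hQ
  have hfrob' := (FramedGaloisRep.hasFrobCharpolyAt_toGaloisRep_iff v _ ρ).mpr hfrob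
  rwa [GaloisRep.HasFrobCharpolyAt.unique_holds hQ' hfrob']

/-- **Hypothesis (3) of `bcgp_switch_exists_modular_abelianSurface` in the `frobCharpoly`
vocabulary**: at `v ∣ 2`, "`ρ̄` unramified and every `Q` with `HasFrobCharpolyAt v Q` differs
from `(X² ± X + 2)²`" is "`ρ̄` unramified and `frobCharpoly ρ̄ v ≠ (X² ± X + 2)²`" — the printed
"`ρ̄|_{G_{ℚ₂}}` is unramified and the characteristic polynomial of `ρ̄(Frob₂)` is not
`(x² ± x + 2)²`" (Thm. 9.5.2 (2), Lemma 9.4.2 (1)(a) via Lemma 9.1.3).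
[cite: BoxerCalegariGeePilloni2025, Thm. 9.5.2 (2) and Lemma 9.4.2 (1)(a)] -/
theorem bcgp_switch_hypothesisAtTwo_iff_frobCharpoly (ρb : FramedGaloisRep ℚ (ZMod 3) 4)
    (v : HeightOneSpectrum (𝓞 ℚ)) :
    (ρb.IsUnramifiedAt v ∧
        ∀ Q : Polynomial (ZMod 3), ρb.HasFrobCharpolyAt v Q →
          Q ≠ (Polynomial.X ^ 2 + Polynomial.X + 2) ^ 2 ∧
            Q ≠ (Polynomial.X ^ 2 - Polynomial.X + 2) ^ 2) ↔
      (ρb.IsUnramifiedAt v ∧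
        ρb.toGaloisRep.frobCharpoly v ≠ (Polynomial.X ^ 2 + Polynomial.X + 2) ^ 2 ∧
          ρb.toGaloisRep.frobCharpoly v ≠ (Polynomial.X ^ 2 - Polynomial.X + 2) ^ 2) :=
  ρb.isUnramifiedAt_and_forall_hasFrobCharpolyAt_iff v fun Q =>
    Q ≠ (Polynomial.X ^ 2 + Polynomial.X + 2) ^ 2 ∧ Q ≠ (Polynomial.X ^ 2 - Polynomial.X + 2) ^ 2

end FrobCharpolyForm

/-! ## Part 7 (appended). The conclusion, consumable: the cohomological frame `(b, r)` exists

The conclusion of the fact quantifies its characteristic-polynomial and modularity clauses over ALL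
pairs `(b, r)` — a `ℚ₃`-basis `b` of `V₃ B` and a framed continuous `r : Γ_ℚ → GL₄(ℚ̄₃)` with
`r(g) = [g⁻¹]_bᵀ`.  Such a pair EXISTS for every abelian variety and every prime invertible in the
base field (`AbelianVariety.exists_basis_dualFramedRationalTateRep`: `dim V_p B = 2 dim B`,
continuity of the Galois action, `ContinuousRep.frame`, `FramedRep.dual`, `FramedRep.baseChange`),
so a consumer holding the fact and a `ρ̄` with hypotheses (1)–(3) obtains `B` WITH a frame for which
the congruence and the modularity hold (`bcgp_switch_exists_modular_abelianSurface_elim`). -/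

section ConclusionFrame

open IsDedekindDomain Field Matrix CategoryTheory

universe u

/-- **The cohomological frames of the conclusion exist** (any abelian variety `B/K`, any prime `p`
invertible in `K`): there are a `ℚ_p`-basis `b` of `V_p B` (`dim V_p B = 2 dim B`,
`finrank_rationalTateModule_eq_two_mul_dim`) and a framed CONTINUOUS representation
`r : Γ_K → GL_{2 dim B}(ℚ̄_p)` with `r(g) = [g⁻¹]_bᵀ` — the representation on
`H¹_ét(B_K̄, ℚ̄_p) = (V_p B)^∨ ⊗ ℚ̄_p` in the basis dual to `b`: the dual (`FramedRep.dual`) of the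
frame (`ContinuousRep.frame`, continuity of the Galois action `continuous_rationalTateRep_holds`)
of `V_p B`, base-changed along `ℚ_p → ℚ̄_p` (`FramedRep.baseChange`).  This instantiates the
universally quantified pair `(b, r)` of the conclusion of
`bcgp_switch_exists_modular_abelianSurface`. [cite: SerreTate1968, §1] -/
theorem _root_.Literature.AlgebraicGeometry.Motives.AbelianVariety.exists_basis_dualFramedRationalTateRep
    {K : Type u} [Field K] (B : AbelianVariety K) (p : ℕ) [Fact p.Prime] (hp : (p : K) ≠ 0)
    {d : ℕ} (hd : 2 * B.dim = d) :
    ∃ (b : Module.Basis (Fin d) ℚ_[p] (B.rationalTateModule p))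
      (r : FramedGaloisRep K (PadicAlgCl p) d),
      ∀ g : absoluteGaloisGroup K,
        (r g).val =
          ((LinearMap.toMatrix b b (B.rationalTateRep p g⁻¹)).map
            (algebraMap ℚ_[p] (PadicAlgCl p))).transpose := by
  have hfin : Module.finrank ℚ_[p] (B.rationalTateModule p) = d := by
    rw [B.finrank_rationalTateModule_eq_two_mul_dim p hp, hd]
  haveI := B.module_finite_tateModule_of_cast_ne_zero p hp
  haveI : Module.Finite ℚ_[p] (B.rationalTateModule p) := by
    change Module.Finite ℚ_[p] (ℚ_[p] ⊗[ℤ_[p]] EllipticCurves.TateModule B.geomPoints p)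
    infer_instance
  let b : Module.Basis (Fin d) ℚ_[p] (B.rationalTateModule p) := Module.finBasisOfFinrankEq _ _ hfin
  let ρ : GaloisRep K ℚ_[p] (B.rationalTateModule p) :=
    B.rationalTateGaloisRep p (B.continuous_rationalTateRep_holds p hp)
  refine ⟨b, ((ρ.frame b).dual).baseChange (algebraMap ℚ_[p] (PadicAlgCl p))
    (continuous_algebraMap_padicAlgCl p), fun g => ?_⟩
  rw [FramedRep.baseChange_apply]
  change (((ρ.frame b).dual g).val).map (algebraMap ℚ_[p] (PadicAlgCl p)) = _
  rw [FramedRep.coe_dual_apply, ← map_inv, ContinuousRep.coe_frame_apply, Matrix.transpose_map]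
  rfl

/-- **`bcgp_switch_exists_modular_abelianSurface`, consumable form.**  Feeding the fact a `ρ̄` with
its three hypotheses yields the modular abelian surface `B` together with an EXPLICIT cohomological
frame: a `ℚ₃`-basis `b` of `V₃ B` and the framed `r : Γ_ℚ → GL₄(ℚ̄₃)`, `r(g) = [g⁻¹]_bᵀ`
(`AbelianVariety.exists_basis_dualFramedRationalTateRep`), for which the congruence
`det(X - r(g)) ≡ det(X - ρ̄(g)) (mod 3)` (through `ℤ₃[X]`) and the modularity clause hold — the
conclusion with its `∀ (b, r)` instantiated, ready for a consumer.
[cite: BoxerCalegariGeePilloni2025, Lemma 9.4.2 and Thm. 8.3.2] -/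
theorem bcgp_switch_exists_modular_abelianSurface_elim
    (h : bcgp_switch_exists_modular_abelianSurface) (ρb : FramedGaloisRep ℚ (ZMod 3) 4)
    (h1 : ρb.IsSymplecticWithMultiplierFun
        (fun g => (((modPCyclotomicCharacterZMod ℚ 3 g)⁻¹ : (ZMod 3)ˣ) : ZMod 3)))
    (h2 : ∀ v : HeightOneSpectrum (𝓞 ℚ), ((3 : ℕ) : 𝓞 ℚ) ∈ v.asIdeal →
      ModPGaloisRep.IsPeuRamifie (ρb.toLocal v) ∧
      ∃ g : GL (Fin 4) (ZMod 3),
        (∀ (τ : Field.absoluteGaloisGroup (v.adicCompletion ℚ)) (i j : Fin 4),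
            2 ≤ (i : ℕ) → (j : ℕ) < 2 → (g * ρb.toLocal v τ * g⁻¹).val i j = 0) ∧
        (∀ τ ∈ absInertia (v.adicCompletion ℚ), ∀ i j : Fin 4, (i : ℕ) < 2 → (j : ℕ) < 2 →
            (g * ρb.toLocal v τ * g⁻¹).val i j = if i = j then 1 else 0) ∧
        (∀ τ ∈ absInertia (v.adicCompletion ℚ), ∀ i j : Fin 4, 2 ≤ (i : ℕ) → 2 ≤ (j : ℕ) →
            (g * ρb.toLocal v τ * g⁻¹).val i j =
              if i = j then
                (((modPCyclotomicCharacterZMod ℚ 3 (absGaloisRestrict ℚ (v.adicCompletion ℚ) τ))⁻¹ :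
                    (ZMod 3)ˣ) : ZMod 3)
              else 0))
    (h3 : ∀ v : HeightOneSpectrum (𝓞 ℚ), ((2 : ℕ) : 𝓞 ℚ) ∈ v.asIdeal →
      ρb.IsUnramifiedAt v ∧
        ∀ Q : Polynomial (ZMod 3), ρb.HasFrobCharpolyAt v Q →
          Q ≠ (Polynomial.X ^ 2 + Polynomial.X + 2) ^ 2 ∧
            Q ≠ (Polynomial.X ^ 2 - Polynomial.X + 2) ^ 2) :
    ∃ B : AbelianVariety ℚ,
      B.dim = 2 ∧
      (∀ v : HeightOneSpectrum (𝓞 ℚ), ((3 : ℕ) : 𝓞 ℚ) ∈ v.asIdeal →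
        B.HasGoodOrdinaryReductionAt v) ∧
      (∀ f : B ⟶ B, ∃ n : ℤ, f = n • 𝟙 B) ∧
      ∃ (b : Module.Basis (Fin 4) ℚ_[3] (B.rationalTateModule 3))
        (r : FramedGaloisRep ℚ (PadicAlgCl 3) 4),
        (∀ g : Field.absoluteGaloisGroup ℚ,
          (r g).val =
            ((LinearMap.toMatrix b b (B.rationalTateRep 3 g⁻¹)).map
              (algebraMap ℚ_[3] (PadicAlgCl 3))).transpose) ∧
        (∀ g : Field.absoluteGaloisGroup ℚ, ∃ P : Polynomial ℤ_[3],
            P.map (algebraMap ℤ_[3] (PadicAlgCl 3)) = FramedRep.charpoly r g ∧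
            P.map (PadicInt.toZMod (p := 3)) = FramedRep.charpoly ρb g) ∧
        ∀ (hcpt : Automorphic.isCompact_glFiniteIntegralLevel 4 ℚ) (ι : PadicAlgCl 3 ≃+* ℂ),
          ∃ π : Automorphic.CuspidalAutomorphicRepData 4 ℚ hcpt, π.1.IsLAlgebraic ∧
            ∀ᶠ v : HeightOneSpectrum (𝓞 ℚ) in Filter.cofinite, ∃ a : Multiset ℂ,
              π.1.HasSatakeParamAt v a ∧ r.IsUnramifiedAt v ∧
                r.HasFrobCharpolyAt v (Automorphic.arithFrobPolyOfSatake ι v.residueCard 1 a) := by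
  obtain ⟨B, hdim, hord, hend, hC4⟩ := h ρb h1 h2 h3
  obtain ⟨b, r, hr⟩ :=
    B.exists_basis_dualFramedRationalTateRep 3 (by norm_num) (d := 4) (by rw [hdim])
  exact ⟨B, hdim, hord, hend, b, r, hr, hC4 b r hr⟩

end ConclusionFrame

/-! ## Part 8 (appended). `ρ̄` is residually automorphic on `GL₄/ℚ`

What the `2`–`3` switch is FOR (proof of Thm. 9.5.2): the given `ρ̄ : G_ℚ → GSp₄(𝔽₃)` becomes the
reduction of the `3`-adic Galois representation of a cuspidal automorphic representation of
`GL₄(𝔸_ℚ)`.  In the tree's Satake-parameter language: the Satake polynomials of `π` at almost all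
`v` are `3`-integral and reduce mod `3` to the characteristic polynomials of `ρ̄` at the Frobenii
above `v` (`bcgp_switch_residually_automorphic`, from Part 7). -/

section ResidualAutomorphy

open IsDedekindDomain Field

/-- `ℤ₃ → ℚ̄₃` is injective (through `ℚ₃`). [folklore] -/
private theorem algebraMap_padicInt_padicAlgCl_injective (p : ℕ) [Fact p.Prime] :
    Function.Injective (algebraMap ℤ_[p] (PadicAlgCl p)) := by
  rw [IsScalarTower.algebraMap_eq ℤ_[p] ℚ_[p] (PadicAlgCl p)]
  exact (algebraMap ℚ_[p] (PadicAlgCl p)).injective.comp (IsFractionRing.injective ℤ_[p] ℚ_[p])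

/-- **`ρ̄` is residually automorphic on `GL₄/ℚ`** (the `2`–`3` switch, as used): under the
hypotheses of `bcgp_switch_exists_modular_abelianSurface`, for every `ι : ℚ̄₃ ≃ ℂ` there is an
L-algebraic cuspidal automorphic representation `π` of `GL₄(𝔸_ℚ)` — the transfer of the weight-2
form of the modular abelian surface `B` through which the switch is made — such that at almost all
finite places `v` the Satake polynomial `∏ⱼ (X - ι⁻¹(a_{v,j}⁻¹))` of `π_v`
(`arithFrobPolyOfSatake ι q_v 1 a_v`) is `3`-integral, i.e. the image of some `P_v ∈ ℤ₃[X]`, whose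
reduction mod `3` is the characteristic polynomial of `ρ̄` at EVERY arithmetic Frobenius above `v`:
`ρ̄` is the reduction of the `3`-adic Galois representation of `π`.  (From
`bcgp_switch_exists_modular_abelianSurface_elim`: `P_v` is the polynomial of the congruence clause
at a Frobenius `σ`; it maps to `det(X - r(σ))`, which is the Satake polynomial as `r` is unramified
at `v` with `HasFrobCharpolyAt`; independence of `σ` by injectivity of `ℤ₃[X] → ℚ̄₃[X]`.)
[cite: BoxerCalegariGeePilloni2025, Lemma 9.4.2, Thm. 8.3.2 and the proof of Thm. 9.5.2] -/
theorem bcgp_switch_residually_automorphic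
    (h : bcgp_switch_exists_modular_abelianSurface) (ρb : FramedGaloisRep ℚ (ZMod 3) 4)
    (h1 : ρb.IsSymplecticWithMultiplierFun
        (fun g => (((modPCyclotomicCharacterZMod ℚ 3 g)⁻¹ : (ZMod 3)ˣ) : ZMod 3)))
    (h2 : ∀ v : HeightOneSpectrum (𝓞 ℚ), ((3 : ℕ) : 𝓞 ℚ) ∈ v.asIdeal →
      ModPGaloisRep.IsPeuRamifie (ρb.toLocal v) ∧
      ∃ g : GL (Fin 4) (ZMod 3),
        (∀ (τ : Field.absoluteGaloisGroup (v.adicCompletion ℚ)) (i j : Fin 4),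
            2 ≤ (i : ℕ) → (j : ℕ) < 2 → (g * ρb.toLocal v τ * g⁻¹).val i j = 0) ∧
        (∀ τ ∈ absInertia (v.adicCompletion ℚ), ∀ i j : Fin 4, (i : ℕ) < 2 → (j : ℕ) < 2 →
            (g * ρb.toLocal v τ * g⁻¹).val i j = if i = j then 1 else 0) ∧
        (∀ τ ∈ absInertia (v.adicCompletion ℚ), ∀ i j : Fin 4, 2 ≤ (i : ℕ) → 2 ≤ (j : ℕ) →
            (g * ρb.toLocal v τ * g⁻¹).val i j =
              if i = j then
                (((modPCyclotomicCharacterZMod ℚ 3 (absGaloisRestrict ℚ (v.adicCompletion ℚ) τ))⁻¹ :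
                    (ZMod 3)ˣ) : ZMod 3)
              else 0))
    (h3 : ∀ v : HeightOneSpectrum (𝓞 ℚ), ((2 : ℕ) : 𝓞 ℚ) ∈ v.asIdeal →
      ρb.IsUnramifiedAt v ∧
        ∀ Q : Polynomial (ZMod 3), ρb.HasFrobCharpolyAt v Q →
          Q ≠ (Polynomial.X ^ 2 + Polynomial.X + 2) ^ 2 ∧
            Q ≠ (Polynomial.X ^ 2 - Polynomial.X + 2) ^ 2)
    (hcpt : Automorphic.isCompact_glFiniteIntegralLevel 4 ℚ) (ι : PadicAlgCl 3 ≃+* ℂ) :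
    ∃ π : Automorphic.CuspidalAutomorphicRepData 4 ℚ hcpt, π.1.IsLAlgebraic ∧
      ∀ᶠ v : HeightOneSpectrum (𝓞 ℚ) in Filter.cofinite,
        ∃ (a : Multiset ℂ) (P : Polynomial ℤ_[3]),
          π.1.HasSatakeParamAt v a ∧
          P.map (algebraMap ℤ_[3] (PadicAlgCl 3)) =
            Automorphic.arithFrobPolyOfSatake ι v.residueCard 1 a ∧
          ∀ 𝔓 ∈ v.primesAbove, ∀ σ : Field.absoluteGaloisGroup ℚ, IsArithFrobAt (𝓞 ℚ) σ 𝔓 →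
            P.map (PadicInt.toZMod (p := 3)) = FramedRep.charpoly ρb σ := by
  obtain ⟨B, -, -, -, b, r, -, hcong, hmod⟩ :=
    bcgp_switch_exists_modular_abelianSurface_elim h ρb h1 h2 h3
  obtain ⟨π, hL, hev⟩ := hmod hcpt ι
  refine ⟨π, hL, hev.mono ?_⟩
  rintro v ⟨a, ha, -, hfrob⟩
  obtain ⟨𝔓₀, h𝔓₀⟩ := HeightOneSpectrum.primesAbove_nonempty v
  obtain ⟨σ₀, hσ₀⟩ := HeightOneSpectrum.exists_isArithFrobAt_of_mem_primesAbove_holds h𝔓₀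
  obtain ⟨P, hP₁, hP₂⟩ := hcong σ₀
  refine ⟨a, P, ha, by rw [hP₁, hfrob 𝔓₀ h𝔓₀ σ₀ hσ₀], fun 𝔓 h𝔓 σ hσ => ?_⟩
  obtain ⟨P', hP'₁, hP'₂⟩ := hcong σ
  have hPP' : P' = P :=
    Polynomial.map_injective _ (algebraMap_padicInt_padicAlgCl_injective 3)
      (by rw [hP'₁, hP₁, hfrob 𝔓 h𝔓 σ hσ, hfrob 𝔓₀ h𝔓₀ σ₀ hσ₀])
  rw [← hPP', hP'₂]

end ResidualAutomorphy

/-! ## Part 9 (appended). User-level entry point with the lighter hypotheses of Parts 3 and 6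

`bcgp_switch_exists_modular_abelianSurface_elim'`: the fact applied with only the first two block
clauses at `v ∣ 3` (the third is a consequence of symplecticity, Part 3) and with hypothesis (3) in
the `frobCharpoly` form (Part 6), returning the modular abelian surface with its frame (Part 7). -/

section EntryPoint

open IsDedekindDomain Field CategoryTheory

/-- **User-level entry point to `bcgp_switch_exists_modular_abelianSurface`.**  The fact applied
with the LIGHTER hypotheses justified in Parts 3 and 6: at `v ∣ 3` only the first two block clauses
(block upper-triangular frame, inertia trivial on the sub-block) besides peu ramifié — the third
clause (inertia acts by `ε̄⁻¹` on the quotient block) follows from symplecticity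
(`bcgp_switch_hypothesisAtThree_inertia_quotient`); at `v ∣ 2` unramifiedness and the condition on
the tree's chosen `frobCharpoly` (`bcgp_switch_hypothesisAtTwo_iff_frobCharpoly`).  Output: the
modular abelian surface with its cohomological frame instantiated
(`bcgp_switch_exists_modular_abelianSurface_elim`).
[cite: BoxerCalegariGeePilloni2025, Lemma 9.4.2, Cor. 9.3.5, Thm. 9.5.2 (2), Thm. 8.3.2] -/
theorem bcgp_switch_exists_modular_abelianSurface_elim'
    (h : bcgp_switch_exists_modular_abelianSurface) (ρb : FramedGaloisRep ℚ (ZMod 3) 4)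
    (h1 : ρb.IsSymplecticWithMultiplierFun
        (fun g => (((modPCyclotomicCharacterZMod ℚ 3 g)⁻¹ : (ZMod 3)ˣ) : ZMod 3)))
    (h2 : ∀ v : HeightOneSpectrum (𝓞 ℚ), ((3 : ℕ) : 𝓞 ℚ) ∈ v.asIdeal →
      ModPGaloisRep.IsPeuRamifie (ρb.toLocal v) ∧
      ∃ g : GL (Fin 4) (ZMod 3),
        (∀ (τ : Field.absoluteGaloisGroup (v.adicCompletion ℚ)) (i j : Fin 4),
            2 ≤ (i : ℕ) → (j : ℕ) < 2 → (g * ρb.toLocal v τ * g⁻¹).val i j = 0) ∧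
        (∀ τ ∈ absInertia (v.adicCompletion ℚ), ∀ i j : Fin 4, (i : ℕ) < 2 → (j : ℕ) < 2 →
            (g * ρb.toLocal v τ * g⁻¹).val i j = if i = j then 1 else 0))
    (h3 : ∀ v : HeightOneSpectrum (𝓞 ℚ), ((2 : ℕ) : 𝓞 ℚ) ∈ v.asIdeal →
      ρb.IsUnramifiedAt v ∧
        ρb.toGaloisRep.frobCharpoly v ≠ (Polynomial.X ^ 2 + Polynomial.X + 2) ^ 2 ∧
          ρb.toGaloisRep.frobCharpoly v ≠ (Polynomial.X ^ 2 - Polynomial.X + 2) ^ 2) :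
    ∃ B : AbelianVariety ℚ,
      B.dim = 2 ∧
      (∀ v : HeightOneSpectrum (𝓞 ℚ), ((3 : ℕ) : 𝓞 ℚ) ∈ v.asIdeal →
        B.HasGoodOrdinaryReductionAt v) ∧
      (∀ f : B ⟶ B, ∃ n : ℤ, f = n • 𝟙 B) ∧
      ∃ (b : Module.Basis (Fin 4) ℚ_[3] (B.rationalTateModule 3))
        (r : FramedGaloisRep ℚ (PadicAlgCl 3) 4),
        (∀ g : Field.absoluteGaloisGroup ℚ,
          (r g).val =
            ((LinearMap.toMatrix b b (B.rationalTateRep 3 g⁻¹)).map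
              (algebraMap ℚ_[3] (PadicAlgCl 3))).transpose) ∧
        (∀ g : Field.absoluteGaloisGroup ℚ, ∃ P : Polynomial ℤ_[3],
            P.map (algebraMap ℤ_[3] (PadicAlgCl 3)) = FramedRep.charpoly r g ∧
            P.map (PadicInt.toZMod (p := 3)) = FramedRep.charpoly ρb g) ∧
        ∀ (hcpt : Automorphic.isCompact_glFiniteIntegralLevel 4 ℚ) (ι : PadicAlgCl 3 ≃+* ℂ),
          ∃ π : Automorphic.CuspidalAutomorphicRepData 4 ℚ hcpt, π.1.IsLAlgebraic ∧
            ∀ᶠ v : HeightOneSpectrum (𝓞 ℚ) in Filter.cofinite, ∃ a : Multiset ℂ,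
              π.1.HasSatakeParamAt v a ∧ r.IsUnramifiedAt v ∧
                r.HasFrobCharpolyAt v (Automorphic.arithFrobPolyOfSatake ι v.residueCard 1 a) := by
  refine bcgp_switch_exists_modular_abelianSurface_elim h ρb h1 (fun v hv => ?_) (fun v hv => ?_)
  · obtain ⟨hpeu, g, htri, hsub⟩ := h2 v hv
    exact ⟨hpeu, g, htri, hsub, bcgp_switch_hypothesisAtThree_inertia_quotient ρb h1 hv g htri hsub⟩
  · exact (bcgp_switch_hypothesisAtTwo_iff_frobCharpoly ρb v).mpr (h3 v hv)

end EntryPoint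

/-! ## Part 10 (appended). The fact from its two printed ingredients: Lemma 9.4.2 and Theorem 8.3.2

The docstring of `bcgp_switch_exists_modular_abelianSurface` describes it as "Lemma 9.4.2 (2) with its
Moreover, the 2-adic ordinary modularity Theorem 8.3.2 (residually `A₅(b)`) and the transfer
`GSp₄ → GL₄`, combined VERBATIM as in the first half of the proof of Thm. 9.5.2".  This Part PROVES that
combination: the fact follows from the two printed ingredients, each stated here — as a HYPOTHESIS, in the
tree's vocabulary, hypotheses complete — exactly as published:

* `h₁` = **Lemma 9.4.2 (2)(a)–(d) with its "Moreover"** (p. 135): under the SAME three hypotheses as the fact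
  (similitude `ε̄⁻¹`; `ρ̄^∨|_{G_{ℚ₃}}` ordinary and finite flat; unramified at `2` with (1)(a)), there is an
  abelian surface `B/ℚ` (printed: `B = Jac(X)`, `X/ℚ` of genus `2` with a rational Weierstrass point) with
  (a) `ρ̄_{B,3} ≅ ρ̄` — a contragredient additive frame `e₃` of `B[3](ℚ̄)`, `e₃(g • P) = ρ̄(g⁻¹)ᵀ e₃(P)`
  (§1.8.11: `ρ̄_{B,3} = B[3]^∨`); (b) "good ordinary or semistable ordinary reduction at `2`, and
  `2`-distinguished" — semistable (possibly good) reduction at `2` in Grothendieck's Galois form (inertia at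
  `2` acts on every `V_ℓ(B)`, `ℓ ≠ 2`, with `(ρ_ℓ(τ) - 1)² = 0`; SGA 7 I, Exp. IX, 3.5) and the framed dual
  `r₂` of `V₂(B)` ordinary and `2`-distinguished at `v ∣ 2` (Def. 9.1.2 → Def. 1.8.8; the accepted
  `FramedGaloisRep.IsOrdinaryPDistinguishedAt`, `GaloisRepresentations/OrdinaryPDistinguished.lean`);
  (c) good ordinary reduction at `3`; (d) "`ρ̄_{B,2}` has image `S₅(b)` and complex conjugation has class
  `(**)(**)`" — an additive frame `e₂` of `B[2](ℚ̄)` in which every `g` acts by some `s5bMatrix σ` (the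
  accepted matrices of `S₅(b) ⊂ S₆ ≅ Sp₄(𝔽₂)` on `U⁰/L`, §8.1, `GenusTwoTwoTorsionS5b.lean`), every
  `σ ∈ S₅` occurs, and every complex conjugation (`IsComplexConjugation (algebraMap ℚ ℝ) c`) acts by
  `s5bMatrix σ` with `σ.cycleType = {2,2}`; (Moreover) every endomorphism of `B_ℚ̄` is `n · 𝟙`.
* `h₂` = **Theorem 8.3.2** (p. 124) in the `GL₄` form of Remark 1.8.9 / §1.8.10 / Def. 1.8.12: an abelian
  surface `B/ℚ` with (1)–(2) `A₅(b) ⊆ im ρ̄_{B,2} ⊆ S₅(b)` and every complex conjugation of order `2` in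
  `A₅(b)` (frame `e₂` as above: every `g` acts by some `s5bMatrix σ`, every EVEN `σ` occurs, complex
  conjugations act by double transpositions — the involutions of `A₅`), and (3) good ordinary or semistable
  reduction at `2` with `ρ_{B,2}|_{G_{ℚ₂}}` ordinary and `2`-distinguished (as in (b)), is modular: for EVERY
  prime `p` and dual frame `(b, r)` of `V_p(B)`, the almost-everywhere `GL₄` clause of the fact.

Both are theorems of the cited paper whose proofs are theories absent from Mathlib and the tree (moduli
`P(ρ̄)`, `M^w_2(ρ̄)` and their rationality, thin sets, Kisin–Krasner, Serre–Tate lifting, Zarhin; `2`-adic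
patching for `GSp₄`, higher Hida theory, classicality, Arthur's transfer); they are NOT vendored as named
facts by this proving seat (D-0026) — the hypotheses ARE their statements, ready to be named by a
route-level split, after which `bcgp_switch_exists_modular_abelianSurface_holds` is this theorem applied to
the two `_holds`.  The proof is the printed one (proof of Thm. 9.5.2, pp. 136–137): "By Lemma 9.4.2 (2) […]
there exists a genus two curve `X/ℚ` with a rational Weierstrass point, with `B = Jac(X)` having the
following properties: […].  We shall first apply Theorem 8.3.2 […] (we take `A` there to be our `B`) to
deduce that `B` is modular.  To recall, the hypotheses of Theorem 8.3.2 are as follows: `A₅(b) ⊆ ρ̄_{B,2}(G_ℚ)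
⊆ S₅(b)`.  The image of each complex conjugation has order `2` and lands in `A₅(b)`.  `ρ_{B,2}|_{G_{ℚ₂}}` is
ordinary and `2`-distinguished.  All of these conditions are guaranteed by the properties of `B` listed
above, noting that `(**)(**)` is a non-trivial conjugacy class contained in `A₅(b)`.  Thus `B` is modular.":
(d) ⟹ (1)–(2) (every `σ` occurs, in particular every even one), (b) = (3) verbatim; then (a) gives the
characteristic-polynomial clause by Part 1 (`bcgp_switch_charpolyClause`), "Moreover" gives the endomorphism
clause by Part 5 (`bcgp_switch_endClause_of_geomEnd`), (c) and `dim B = 2` are carried over, and the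
modularity clause is Thm. 8.3.2's conclusion at `p = 3` for the frame `(b, r)`. -/

section FromIngredients

open CategoryTheory IsDedekindDomain Literature.NumberTheory.Automorphic

/-- **`bcgp_switch_exists_modular_abelianSurface` from BCGP Lemma 9.4.2 and Theorem 8.3.2** (the first
half of the proof of Thm. 9.5.2, formalised; see the Part 10 header for the clause-by-clause reading of the
two hypotheses, which are the printed Lemma 9.4.2 (2)+Moreover and Thm. 8.3.2 (`GL₄` form) in the tree's
vocabulary): the switching surface `B` of `h₁` satisfies the hypotheses of `h₂` ((d) ⟹ (1)–(2), (b) = (3)),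
so it is modular for every `p`, in particular for `p = 3` and every dual frame `(b, r)` of `V₃(B)`; with
(a) ⟹ the characteristic-polynomial clause (`bcgp_switch_charpolyClause`), (c), `dim B = 2` and
"Moreover" ⟹ `End_ℚ(B) = ℤ · id` (`bcgp_switch_endClause_of_geomEnd`) this is every clause of the fact.
[cite: BoxerCalegariGeePilloni2025, proof of Thm. 9.5.2 (first half: Lemma 9.4.2 (2) + Thm. 8.3.2); Lemma 9.4.2; Thm. 8.3.2; Remark 1.8.9, §1.8.10, Def. 1.8.12; §8.1; Def. 1.8.8; Def. 9.1.2]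
[cite: GrothendieckSGA7IX, Exp. IX §3, 3.5 (semistable reduction in Galois form)] -/
theorem bcgp_switch_exists_modular_abelianSurface_of_lemma942_of_theorem832
    (h₁ :
      ∀ (ρb : FramedGaloisRep ℚ (ZMod 3) 4),
        ρb.IsSymplecticWithMultiplierFun
            (fun g => (((modPCyclotomicCharacterZMod ℚ 3 g)⁻¹ : (ZMod 3)ˣ) : ZMod 3)) →
        (∀ v : HeightOneSpectrum (𝓞 ℚ), ((3 : ℕ) : 𝓞 ℚ) ∈ v.asIdeal →
          ModPGaloisRep.IsPeuRamifie (ρb.toLocal v) ∧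
          ∃ g : GL (Fin 4) (ZMod 3),
            (∀ (τ : Field.absoluteGaloisGroup (v.adicCompletion ℚ)) (i j : Fin 4),
                2 ≤ (i : ℕ) → (j : ℕ) < 2 → (g * ρb.toLocal v τ * g⁻¹).val i j = 0) ∧
            (∀ τ ∈ absInertia (v.adicCompletion ℚ), ∀ i j : Fin 4, (i : ℕ) < 2 → (j : ℕ) < 2 →
                (g * ρb.toLocal v τ * g⁻¹).val i j = if i = j then 1 else 0) ∧
            (∀ τ ∈ absInertia (v.adicCompletion ℚ), ∀ i j : Fin 4, 2 ≤ (i : ℕ) → 2 ≤ (j : ℕ) →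
                (g * ρb.toLocal v τ * g⁻¹).val i j =
                  if i = j then
                    (((modPCyclotomicCharacterZMod ℚ 3 (absGaloisRestrict ℚ (v.adicCompletion ℚ) τ))⁻¹ :
                        (ZMod 3)ˣ) : ZMod 3)
                  else 0)) →
        (∀ v : HeightOneSpectrum (𝓞 ℚ), ((2 : ℕ) : 𝓞 ℚ) ∈ v.asIdeal →
          ρb.IsUnramifiedAt v ∧
            ∀ Q : Polynomial (ZMod 3), ρb.HasFrobCharpolyAt v Q →
              Q ≠ (Polynomial.X ^ 2 + Polynomial.X + 2) ^ 2 ∧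
                Q ≠ (Polynomial.X ^ 2 - Polynomial.X + 2) ^ 2) →
        ∃ B : AbelianVariety ℚ,
          B.dim = 2 ∧
          (∃ e₃ : B.geomTorsion (3 : ℕ) ≃+ (Fin 4 → ZMod 3),
            ∀ (g : Field.absoluteGaloisGroup ℚ) (P : B.geomTorsion (3 : ℕ)),
              e₃ (g • P) =
                ((ρb g⁻¹ : GL (Fin 4) (ZMod 3)) : Matrix (Fin 4) (Fin 4) (ZMod 3))ᵀ *ᵥ e₃ P) ∧
          (∀ (ℓ : ℕ) [Fact ℓ.Prime], ℓ ≠ 2 →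
            ∀ v : HeightOneSpectrum (𝓞 ℚ), ((2 : ℕ) : 𝓞 ℚ) ∈ v.asIdeal →
              ∀ τ ∈ absInertia (v.adicCompletion ℚ),
                (B.rationalTateRep ℓ (absGaloisRestrict ℚ (v.adicCompletion ℚ) τ) - 1) ^ 2 = 0) ∧
          (∀ (b₂ : Module.Basis (Fin 4) ℚ_[2] (B.rationalTateModule 2))
              (r₂ : FramedGaloisRep ℚ (PadicAlgCl 2) 4),
              (∀ g : Field.absoluteGaloisGroup ℚ,
                (r₂ g).val =
                  ((LinearMap.toMatrix b₂ b₂ (B.rationalTateRep 2 g⁻¹)).map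
                    (algebraMap ℚ_[2] (PadicAlgCl 2))).transpose) →
              ∀ v : HeightOneSpectrum (𝓞 ℚ), ((2 : ℕ) : 𝓞 ℚ) ∈ v.asIdeal →
                r₂.IsOrdinaryPDistinguishedAt v) ∧
          (∀ v : HeightOneSpectrum (𝓞 ℚ), ((3 : ℕ) : 𝓞 ℚ) ∈ v.asIdeal →
            B.HasGoodOrdinaryReductionAt v) ∧
          (∃ e₂ : B.geomTorsion (2 : ℕ) ≃+ (Fin 4 → ZMod 2),
            (∀ g : Field.absoluteGaloisGroup ℚ, ∃ σ : Equiv.Perm (Fin 5),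
                ∀ P : B.geomTorsion (2 : ℕ), e₂ (g • P) = s5bMatrix σ *ᵥ e₂ P) ∧
            (∀ σ : Equiv.Perm (Fin 5), ∃ g : Field.absoluteGaloisGroup ℚ,
                ∀ P : B.geomTorsion (2 : ℕ), e₂ (g • P) = s5bMatrix σ *ᵥ e₂ P) ∧
            (∀ c : Field.absoluteGaloisGroup ℚ, IsComplexConjugation (algebraMap ℚ ℝ) c →
                ∃ σ : Equiv.Perm (Fin 5), σ.cycleType = {2, 2} ∧
                  ∀ P : B.geomTorsion (2 : ℕ), e₂ (c • P) = s5bMatrix σ *ᵥ e₂ P)) ∧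
          (∀ f : B.baseChange (AlgebraicClosure ℚ) ⟶ B.baseChange (AlgebraicClosure ℚ),
            ∃ n : ℤ, f = n • 𝟙 (B.baseChange (AlgebraicClosure ℚ))))
    (h₂ :
      ∀ (B : AbelianVariety ℚ), B.dim = 2 →
        (∃ e : B.geomTorsion (2 : ℕ) ≃+ (Fin 4 → ZMod 2),
          (∀ g : Field.absoluteGaloisGroup ℚ, ∃ σ : Equiv.Perm (Fin 5),
              ∀ P : B.geomTorsion (2 : ℕ), e (g • P) = s5bMatrix σ *ᵥ e P) ∧
          (∀ σ : Equiv.Perm (Fin 5), Equiv.Perm.sign σ = 1 →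
              ∃ g : Field.absoluteGaloisGroup ℚ,
                ∀ P : B.geomTorsion (2 : ℕ), e (g • P) = s5bMatrix σ *ᵥ e P) ∧
          (∀ c : Field.absoluteGaloisGroup ℚ, IsComplexConjugation (algebraMap ℚ ℝ) c →
              ∃ σ : Equiv.Perm (Fin 5), σ.cycleType = {2, 2} ∧
                ∀ P : B.geomTorsion (2 : ℕ), e (c • P) = s5bMatrix σ *ᵥ e P)) →
        (∀ (ℓ : ℕ) [Fact ℓ.Prime], ℓ ≠ 2 →
          ∀ v : HeightOneSpectrum (𝓞 ℚ), ((2 : ℕ) : 𝓞 ℚ) ∈ v.asIdeal →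
            ∀ τ ∈ absInertia (v.adicCompletion ℚ),
              (B.rationalTateRep ℓ (absGaloisRestrict ℚ (v.adicCompletion ℚ) τ) - 1) ^ 2 = 0) →
        (∀ (b₂ : Module.Basis (Fin 4) ℚ_[2] (B.rationalTateModule 2))
            (r₂ : FramedGaloisRep ℚ (PadicAlgCl 2) 4),
            (∀ g : Field.absoluteGaloisGroup ℚ,
              (r₂ g).val =
                ((LinearMap.toMatrix b₂ b₂ (B.rationalTateRep 2 g⁻¹)).map
                  (algebraMap ℚ_[2] (PadicAlgCl 2))).transpose) →
            ∀ v : HeightOneSpectrum (𝓞 ℚ), ((2 : ℕ) : 𝓞 ℚ) ∈ v.asIdeal →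
              r₂.IsOrdinaryPDistinguishedAt v) →
        ∀ (p : ℕ) [Fact p.Prime] (b : Module.Basis (Fin 4) ℚ_[p] (B.rationalTateModule p))
          (r : FramedGaloisRep ℚ (PadicAlgCl p) 4),
          (∀ g : Field.absoluteGaloisGroup ℚ,
            (r g).val =
              ((LinearMap.toMatrix b b (B.rationalTateRep p g⁻¹)).map
                (algebraMap ℚ_[p] (PadicAlgCl p))).transpose) →
          ∀ (hcpt : isCompact_glFiniteIntegralLevel 4 ℚ) (ι : PadicAlgCl p ≃+* ℂ),
            ∃ π : CuspidalAutomorphicRepData 4 ℚ hcpt, π.1.IsLAlgebraic ∧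
              ∀ᶠ v : HeightOneSpectrum (𝓞 ℚ) in Filter.cofinite, ∃ a : Multiset ℂ,
                π.1.HasSatakeParamAt v a ∧ r.IsUnramifiedAt v ∧
                  r.HasFrobCharpolyAt v (arithFrobPolyOfSatake ι v.residueCard 1 a)) :
    bcgp_switch_exists_modular_abelianSurface := by
  intro ρb hS h₃ h₂'
  obtain ⟨B, hdim, ⟨e₃, he₃⟩, hss, hord, hgood, ⟨e₂, him, hsurj, hcc⟩, hEnd⟩ := h₁ ρb hS h₃ h₂'
  have hmod := h₂ B hdim ⟨e₂, him, fun σ _ => hsurj σ, hcc⟩ hss hord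
  refine ⟨B, hdim, hgood, bcgp_switch_endClause_of_geomEnd B hEnd, fun b r hr => ⟨?_, ?_⟩⟩
  · exact bcgp_switch_charpolyClause B hdim ρb ⟨e₃, he₃⟩ b r hr
  · intro hcpt ι
    exact hmod 3 b r hr hcpt ι

end FromIngredients

/-! ## Part 11 (appended). The "Moreover" is redundant: `End_ℚ(B) = ℤ` from Lemma 9.4.2 (2)(d)

Boxer–Calegari–Gee–Pilloni 2025, Lemma 9.4.2, p. 135: "Since the image of `ρ̄_{B,2}` is `S₅(b)`, it follows
from [MR1748293] that `End(B_ℚ̄) = ℤ`."  The fact `bcgp_switch_exists_modular_abelianSurface` records only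
`End_ℚ(B) = ℤ · 𝟙`, and for THAT the cited theorem of Zarhin (Math. Res. Lett. 7 (2000), Thm. 2.1) is not
needed in full: its `K`-rational half is elementary and is PROVED here on the tree's `AbelianVariety` —
Zarhin 2000, §1: "Notice that it easily follows that the ring of `K`-endomorphisms of `J(C)` coincides with
`ℤ` and the real problem is how to prove that every endomorphism of `J(C)` is defined over `K`", and §3:
"`R := End(J(C)) ⊗ ℤ/2ℤ ⊂ End_{𝔽₂}(J(C)_2)` […] If `End(J(C)) ⊗ ℤ/2ℤ = R = 𝔽₂ · I` then the free abelian
group `End(J(C))` has rank `1` and therefore coincides with `ℤ`."  Chain: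

* `addMonoidHom_eq_zero_or_eq_id_of_forall_even_s5bMatrix_mulVec` — the commutant of `A₅(b)` in
  `End(V) = M₄(𝔽₂)` is `𝔽₂` (Schur for the absolutely irreducible `V`, from the Burnside statement
  `span_s5bMatrix_even_eq_top` of `GenusTwoTwoTorsionS5bProofs`, Lemma 8.1.1);
* `AbelianVariety.geomPointsMap_eq_zero_or_eq_self_of_s5bFrame` — hence a `K`-endomorphism acts on
  `A[2](K̄)` by `0` or `1` as soon as every even `σ` is realised by Galois in an `s5bMatrix`-frame of `A[2]`
  (hypothesis (2)(d) of Lemma 9.4.2, resp. (1) of Thm. 8.3.2);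
* `AbelianVariety.forall_end_eq_zsmul_id_of_forall_geomTorsion_eq_zsmul` — GENERIC (any abelian variety
  of positive dimension over a field of characteristic `0`, any prime `ℓ`): if every `K`-endomorphism is an
  integer scalar on `A[ℓ](K̄)` then `End_K(A) = ℤ · 𝟙` (Milne 1986, Lemma 12.6 =
  `exists_eq_nsmul_of_forall_geomTorsion`; `End(A)` finitely generated = `module_finite_hom_holds`,
  Mumford §19 Thm. 3; Nakayama over `ℤ`; torsion-freeness and `#A[q] = q^{2 dim A}`);
* `AbelianVariety.forall_end_eq_zsmul_id_of_s5bFrame` — the two combined (`dim A = 2` is forced by the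
  frame);
* `bcgp_switch_exists_modular_abelianSurface_of_lemma942abcd_of_theorem832` — Part 10 with hypothesis
  `h₁` weakened to Lemma 9.4.2 (2)(a)–(d) WITHOUT "Moreover": Zarhin's theorem leaves the inputs of the
  fact. -/

section EndFromTwoTorsion

open CategoryTheory Matrix Equiv
open Literature.AlgebraicGeometry.Motives.AbelianVariety.Hom

universe u

/-- **The commutant of `A₅(b)` in `End(V) = M₄(𝔽₂)` is `𝔽₂`** (Schur's lemma for the absolutely
irreducible `A₅(b) ↷ V = U⁰/L`, Boxer–Calegari–Gee–Pilloni 2025, Lemma 8.1.1): an additive endomorphism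
`F` of `𝔽₂⁴` commuting with every `s5bMatrix σ`, `σ` even, is `0` or the identity.  Proof: `F` is
`𝔽₂`-linear; its matrix commutes with the `𝔽₂`-span of the even `s5bMatrix σ`, which is all of `M₄(𝔽₂)`
(`span_s5bMatrix_even_eq_top`, Burnside), hence with every elementary matrix, so it is a scalar
(`Matrix.mem_range_scalar_iff_commute_single'`), i.e. `0` or `1` over `𝔽₂`.
[cite: BoxerCalegariGeePilloni2025, Lemma 8.1.1] -/
theorem addMonoidHom_eq_zero_or_eq_id_of_forall_even_s5bMatrix_mulVec
    (F : (Fin 4 → ZMod 2) →+ (Fin 4 → ZMod 2))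
    (hF : ∀ σ : Perm (Fin 5), Equiv.Perm.sign σ = 1 →
      ∀ x : Fin 4 → ZMod 2, F (s5bMatrix σ *ᵥ x) = s5bMatrix σ *ᵥ F x) :
    F = 0 ∨ F = AddMonoidHom.id _ := by
  classical
  -- `F` is `𝔽₂`-linear; `N` is its matrix
  set Fl : (Fin 4 → ZMod 2) →ₗ[ZMod 2] (Fin 4 → ZMod 2) := F.toZModLinearMap 2 with hFl
  have hFl_apply : ∀ x, Fl x = F x := fun x => rfl
  set N : Matrix (Fin 4) (Fin 4) (ZMod 2) := LinearMap.toMatrix' Fl with hN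
  have hNx : ∀ x, N *ᵥ x = F x := fun x => by
    rw [hN, LinearMap.toMatrix'_mulVec, hFl_apply]
  -- `N` commutes with `A₅(b)`
  have hcomm : ∀ σ : Perm (Fin 5), Equiv.Perm.sign σ = 1 → Commute (s5bMatrix σ) N := by
    intro σ hσ
    have h : Fl ∘ₗ Matrix.toLin' (s5bMatrix σ) = Matrix.toLin' (s5bMatrix σ) ∘ₗ Fl := by
      refine LinearMap.ext fun x => ?_
      simp only [LinearMap.comp_apply, Matrix.toLin'_apply, hFl_apply, hF σ hσ]
    have h2 := congrArg LinearMap.toMatrix' h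
    rw [LinearMap.toMatrix'_comp, LinearMap.toMatrix'_comp, LinearMap.toMatrix'_toLin'] at h2
    exact h2.symm
  -- hence (Burnside: the span of `A₅(b)` is `M₄(𝔽₂)`) with every matrix
  have hcent : ∀ M : Matrix (Fin 4) (Fin 4) (ZMod 2), Commute M N := by
    intro M
    have hM : M ∈ Submodule.span (ZMod 2) (s5bMatrix '' {σ | Equiv.Perm.sign σ = 1}) := by
      rw [span_s5bMatrix_even_eq_top]; exact Submodule.mem_top
    refine Submodule.span_induction ?_ ?_ ?_ ?_ hM
    · rintro _ ⟨σ, hσ, rfl⟩; exact hcomm σ hσ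
    · exact Commute.zero_left N
    · intro x y _ _ hx hy; exact hx.add_left hy
    · intro a x _ hx; exact hx.smul_left a
  obtain ⟨c, hc⟩ := Matrix.mem_range_scalar_iff_commute_single'.2 fun i j => hcent _
  have h01 : ∀ d : ZMod 2, d = 0 ∨ d = 1 := by decide
  rcases h01 c with rfl | rfl
  · refine Or.inl (AddMonoidHom.ext fun x => ?_)
    rw [← hNx x, ← hc, map_zero, Matrix.zero_mulVec, AddMonoidHom.zero_apply]
  · refine Or.inr (AddMonoidHom.ext fun x => ?_)
    rw [← hNx x, ← hc, map_one, Matrix.one_mulVec, AddMonoidHom.id_apply]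

/-- **`ℚ`-endomorphisms act on `B[2]` by `0` or `1` when `A₅(b) ⊆ im ρ̄_{B,2}`** (any abelian variety `A`
over any field `K`, in the frame vocabulary of Lemma 9.4.2 (2)(d) / Thm. 8.3.2 (1)): if `e` is an additive
frame `A[2](K̄) ≃ 𝔽₂⁴` in which every EVEN `σ ∈ S₅` is realised by some Galois element
(`e (g • P) = s5bMatrix σ · e P`), then every `K`-endomorphism `f` of `A` acts on `A[2](K̄)` either as `0`
or as the identity: `f` commutes with `Γ_K` on `A(K̄)` (`geomPointsMap_smul`), so its restriction to
`A[2]` lies in the commutant of `A₅(b)`, which is `𝔽₂`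
(`addMonoidHom_eq_zero_or_eq_id_of_forall_even_s5bMatrix_mulVec`; Lemma 8.1.1).  This is the step
"`End(J(C)) ⊗ ℤ/2 ⊂ End_{Gal}(J(C)_2) = 𝔽₂ · I`" of Zarhin 2000, §3, for `K`-endomorphisms.
[cite: Zarhin2000, §3 (proof of Thm. 2.1) and Thm. 2.4] [cite: BoxerCalegariGeePilloni2025, Lemma 8.1.1; Lemma 9.4.2 (2)(d)] -/
theorem _root_.Literature.AlgebraicGeometry.Motives.AbelianVariety.geomPointsMap_eq_zero_or_eq_self_of_s5bFrame
    {K : Type u} [Field K] (A : AbelianVariety K)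
    (e : A.geomTorsion (2 : ℕ) ≃+ (Fin 4 → ZMod 2))
    (he : ∀ σ : Perm (Fin 5), Equiv.Perm.sign σ = 1 →
      ∃ g : Field.absoluteGaloisGroup K,
        ∀ P : A.geomTorsion (2 : ℕ), e (g • P) = s5bMatrix σ *ᵥ e P)
    (f : A ⟶ A) :
    (∀ P ∈ A.geomTorsion (2 : ℕ), geomPointsMap f P = 0) ∨
      (∀ P ∈ A.geomTorsion (2 : ℕ), geomPointsMap f P = P) := by
  -- `f` preserves `A[2]`
  have hmem : ∀ P ∈ A.geomTorsion (2 : ℕ), geomPointsMap f P ∈ A.geomTorsion (2 : ℕ) := by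
    intro P hP
    rw [mem_geomTorsion_iff'] at hP ⊢
    rw [← map_zsmul, hP, map_zero]
  set fT : A.geomTorsion (2 : ℕ) →+ A.geomTorsion (2 : ℕ) :=
    ((geomPointsMap f).restrict (A.geomTorsion (2 : ℕ))).codRestrict (A.geomTorsion (2 : ℕ))
      (fun P => hmem P P.2) with hfT
  have hfT_coe : ∀ P : A.geomTorsion (2 : ℕ),
      ((fT P : A.geomTorsion (2 : ℕ)) : A.geomPoints) = geomPointsMap f P := fun P => rfl
  -- Galois equivariance on `A[2]`
  have hfT_smul : ∀ (g : Field.absoluteGaloisGroup K) (P : A.geomTorsion (2 : ℕ)),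
      fT (g • P) = g • fT P := by
    intro g P
    apply Subtype.ext
    rw [hfT_coe, AddSubgroup.torsionBy.coe_smul, AddSubgroup.torsionBy.coe_smul, geomPointsMap_smul,
      hfT_coe]
  -- transport to the frame
  set F : (Fin 4 → ZMod 2) →+ (Fin 4 → ZMod 2) :=
    e.toAddMonoidHom.comp (fT.comp e.symm.toAddMonoidHom) with hFdef
  have hF_apply : ∀ P : A.geomTorsion (2 : ℕ), F (e P) = e (fT P) := by
    intro P
    simp only [hFdef, AddMonoidHom.coe_comp, AddEquiv.coe_toAddMonoidHom, Function.comp_apply,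
      AddEquiv.symm_apply_apply]
  have hF : ∀ σ : Perm (Fin 5), Equiv.Perm.sign σ = 1 →
      ∀ x : Fin 4 → ZMod 2, F (s5bMatrix σ *ᵥ x) = s5bMatrix σ *ᵥ F x := by
    intro σ hσ x
    obtain ⟨g, hg⟩ := he σ hσ
    obtain ⟨P, rfl⟩ := e.surjective x
    rw [← hg P, hF_apply, hF_apply, hfT_smul, hg]
  rcases addMonoidHom_eq_zero_or_eq_id_of_forall_even_s5bMatrix_mulVec F hF with h0 | h1
  · refine Or.inl fun P hP => ?_
    have h := hF_apply ⟨P, hP⟩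
    rw [h0, AddMonoidHom.zero_apply, eq_comm, map_eq_zero_iff _ e.injective] at h
    have h' := congrArg Subtype.val h
    rwa [hfT_coe] at h'
  · refine Or.inr fun P hP => ?_
    have h := hF_apply ⟨P, hP⟩
    rw [h1, AddMonoidHom.id_apply] at h
    have h' := congrArg Subtype.val (e.injective h.symm)
    rwa [hfT_coe] at h'

/-- `(n • f)(P) = n • f(P)` on geometric points (`geomPointsMap` is additive in `f`). [folklore] -/
private theorem gpm_zsmul_apply {K : Type u} [Field K] {A B : AbelianVariety K} (n : ℤ) (f : A ⟶ B)
    (P : A.geomPoints) : geomPointsMap (n • f) P = n • geomPointsMap f P := by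
  rw [← geomPointsMapAddMonoidHom_apply, map_zsmul]
  rfl

/-- From `r • f = m • 𝟙` with `r ≠ 0` to `f ∈ ℤ • 𝟙` (char. `0`, `dim A > 0`): after cancelling
`gcd(r, m)` (torsion-freeness of `End(A)`, `eq_zero_of_zsmul_eq_zero_of_cast_ne_zero`), a prime `q`
dividing the new `r` would kill a nonzero point of `A[q](K̄)` (`#A[q] = q^{2 dim A}`,
`natCard_torsionPoints_of_isAlgClosed_holds`) on the left but act as `m • P ≠ 0` on the right unless
`q ∣ m` — so `r = ±1`. [folklore] -/
private theorem end_eq_zsmul_id_of_zsmul_eq {K : Type u} [Field K] [CharZero K] (A : AbelianVariety K)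
    (hA : 0 < A.dim) {r m : ℤ} (hr0 : r ≠ 0) {f : A ⟶ A} (hrf : r • f = m • 𝟙 A) :
    ∃ n : ℤ, f = n • 𝟙 A := by
  classical
  obtain ⟨g, r', m', hg, hcop, hr', hm'⟩ := Int.exists_gcd_one' (Int.gcd_pos_of_ne_zero_left m hr0)
  have hg0 : ((g : ℤ) : K) ≠ 0 := by exact_mod_cast hg.ne'
  have key : r' • f = m' • 𝟙 A := by
    have h1 : (g : ℤ) • (r' • f - m' • 𝟙 A) = 0 := by
      rw [smul_sub, smul_smul, smul_smul, mul_comm (g : ℤ) r', mul_comm (g : ℤ) m', ← hr', ← hm',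
        hrf, sub_self]
    exact sub_eq_zero.1 (eq_zero_of_zsmul_eq_zero_of_cast_ne_zero (n := (g : ℤ)) hg0 h1)
  have hunit : r'.natAbs = 1 := by
    by_contra hne
    obtain ⟨q, hq, hqr⟩ := Nat.exists_prime_and_dvd hne
    haveI : Fact q.Prime := ⟨hq⟩
    have hqK : (((q : ℕ) : ℤ) : K) ≠ 0 := by exact_mod_cast hq.ne_zero
    -- a nonzero point of `A[q](K̄)`
    haveI : Finite (A.geomTorsion (q : ℕ)) := finite_geomTorsion_of_cast_ne_zero A _ hqK
    have hcard : Nat.card (A.geomTorsion (q : ℕ)) = q ^ (2 * A.dim) := by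
      have := A.natCard_geomTorsion (natCard_torsionPoints_of_isAlgClosed_holds A _) ((q : ℕ) : ℤ) hqK
      rwa [Int.natAbs_natCast] at this
    have hnt : Nontrivial (A.geomTorsion (q : ℕ)) := by
      rw [← Finite.one_lt_card_iff_nontrivial, hcard]
      exact Nat.one_lt_pow (by omega) hq.one_lt
    obtain ⟨P, hP0⟩ := exists_ne (0 : A.geomTorsion (q : ℕ))
    -- `f P ∈ A[q]`, so `r' • f P = 0`, whence `m' • P = 0`
    have hqfP : ((q : ℕ) : ℤ) • geomPointsMap f (P : A.geomPoints) = 0 := by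
      rw [← map_zsmul, (mem_geomTorsion_iff' _).1 P.2, map_zero]
    have hqr' : ((q : ℕ) : ℤ) ∣ r' := Int.natCast_dvd.2 hqr
    have hmP : m' • (P : A.geomPoints) = 0 := by
      have h := congrArg (fun φ : A ⟶ A => geomPointsMap φ (P : A.geomPoints)) key
      simp only [gpm_zsmul_apply, geomPointsMap_id, AddMonoidHom.id_apply] at h
      rw [← h]
      obtain ⟨t, ht⟩ := hqr'
      rw [ht, mul_comm, ← smul_smul, hqfP, smul_zero]
    -- the order of `P` is `q`, so `q ∣ m'`
    have hordP : addOrderOf (P : A.geomPoints) = q := by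
      refine addOrderOf_eq_prime ?_ ?_
      · have := (mem_geomTorsion_iff' _).1 P.2
        rwa [natCast_zsmul] at this
      · exact fun h0 => hP0 (Subtype.ext h0)
    have hqm' : ((q : ℕ) : ℤ) ∣ m' := by
      rw [← hordP]; exact (addOrderOf_dvd_iff_zsmul_eq_zero).2 hmP
    have hunit' : IsUnit ((q : ℕ) : ℤ) :=
      (Int.isCoprime_iff_gcd_eq_one.2 hcop).isUnit_of_dvd' hqr' hqm'
    rcases Int.isUnit_iff.1 hunit' with h1 | h1
    · exact hq.ne_one (by exact_mod_cast h1)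
    · have : (0 : ℤ) ≤ ((q : ℕ) : ℤ) := by positivity
      omega
  rcases Int.natAbs_eq_iff.1 hunit with h1 | h1
  · exact ⟨m', by rw [← key, h1, Nat.cast_one, one_smul]⟩
  · refine ⟨-m', ?_⟩
    have hneg : -f = m' • 𝟙 A := by rw [← key, h1, Nat.cast_one, neg_smul, one_smul]
    rw [neg_smul, ← hneg, neg_neg]

/-- **Endomorphisms scalar on `A[ℓ]` ⟹ `End_K(A) = ℤ`** (Zarhin 2000, §3, the `K`-rational half of the
proof of Thm. 2.1: "If `End(J(C)) ⊗ ℤ/2ℤ = R = 𝔽₂ · I` then the free abelian group `End(J(C))` has rank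
`1` and therefore coincides with `ℤ`"; §1: "it easily follows that the ring of `K`-endomorphisms of `J(C)`
coincides with `ℤ`").  Let `A/K` be an abelian variety of positive dimension over a field of
characteristic `0` and `ℓ` a prime such that every `K`-endomorphism of `A` acts on `A[ℓ](K̄)` as an integer
scalar.  Then every `K`-endomorphism is `n · 𝟙`, `n ∈ ℤ`.  Proof: `f - c · 𝟙` kills `A[ℓ]`, so
`f ∈ ℤ · 𝟙 + ℓ · End(A)` (Milne 1986, Lemma 12.6: `exists_eq_nsmul_of_forall_geomTorsion`); `End(A)` is
finitely generated (Mumford §19, Thm. 3: `module_finite_hom_holds`), so by Nakayama over `ℤ` applied to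
`End(A)/ℤ · 𝟙 = ℓ · (End(A)/ℤ · 𝟙)` there is `r ≡ 1 (mod ℓ)`, `r ≠ 0`, with `r · f ∈ ℤ · 𝟙` for all `f`
(rank `1`); finally `r · f = m · 𝟙` forces `f ∈ ℤ · 𝟙` (`end_eq_zsmul_id_of_zsmul_eq`: torsion-freeness
and the `q`-torsion for primes `q ∣ r`).
[cite: Zarhin2000, §3 (proof of Thm. 2.1) and §1] [cite: Milne1986AbelianVarieties, Lemma 12.6 (PDF p. 191)] [cite: MumfordAV1970, §19 Thm. 3] -/
theorem _root_.Literature.AlgebraicGeometry.Motives.AbelianVariety.forall_end_eq_zsmul_id_of_forall_geomTorsion_eq_zsmul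
    {K : Type u} [Field K] [CharZero K] (A : AbelianVariety K) (hA : 0 < A.dim)
    (ℓ : ℕ) [Fact ℓ.Prime]
    (h : ∀ f : A ⟶ A, ∃ c : ℤ, ∀ P ∈ A.geomTorsion (ℓ : ℕ), geomPointsMap f P = c • P) :
    ∀ f : A ⟶ A, ∃ n : ℤ, f = n • 𝟙 A := by
  classical
  have hℓ : ℓ.Prime := Fact.out
  have hℓK : ((ℓ : ℕ) : K) ≠ 0 := Nat.cast_ne_zero.2 hℓ.ne_zero
  -- Step 1 (Milne 1986, Lemma 12.6): `f ∈ ℤ • 𝟙 + ℓ • End(A)`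
  have step1 : ∀ f : A ⟶ A, ∃ c : ℤ, ∃ ψ : A ⟶ A, f = c • 𝟙 A + (ℓ : ℤ) • ψ := by
    intro f
    obtain ⟨c, hc⟩ := h f
    obtain ⟨ψ, hψ⟩ := exists_eq_nsmul_of_forall_geomTorsion ℓ hℓK (f - c • 𝟙 A) (fun P hP => by
      have hsub : geomPointsMap (f - c • 𝟙 A) P = geomPointsMap f P - c • P := by
        rw [← geomPointsMapAddMonoidHom_apply, map_sub, AddMonoidHom.sub_apply,
          geomPointsMapAddMonoidHom_apply, geomPointsMapAddMonoidHom_apply, gpm_zsmul_apply,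
          geomPointsMap_id, AddMonoidHom.id_apply]
      rw [hsub, hc P hP, sub_self])
    exact ⟨c, ψ, by rw [← hψ]; abel⟩
  -- Step 2 (Nakayama over `ℤ` on `End(A) / ℤ • 𝟙`, `End(A)` finitely generated): rank one
  haveI : Module.Finite ℤ (A ⟶ A) := module_finite_hom_holds A A
  set N₁ : Submodule ℤ (A ⟶ A) := Submodule.span ℤ {𝟙 A} with hN₁
  have hle : (⊤ : Submodule ℤ ((A ⟶ A) ⧸ N₁)) ≤ Ideal.span {(ℓ : ℤ)} • ⊤ := by
    rintro q -
    obtain ⟨f, rfl⟩ := Submodule.Quotient.mk_surjective N₁ q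
    obtain ⟨c, ψ, hf⟩ := step1 f
    have hq : Submodule.Quotient.mk (p := N₁) f = Submodule.Quotient.mk (p := N₁) ((ℓ : ℤ) • ψ) := by
      have h0 : Submodule.Quotient.mk (p := N₁) (c • 𝟙 A) = 0 :=
        (Submodule.Quotient.mk_eq_zero N₁).2 (Submodule.smul_mem N₁ c (Submodule.subset_span rfl))
      rw [hf, Submodule.Quotient.mk_add, h0, zero_add]
    rw [hq, Submodule.Quotient.mk_smul]
    exact Submodule.smul_mem_smul (Ideal.mem_span_singleton_self _) Submodule.mem_top
  haveI : Module.Finite ℤ ((A ⟶ A) ⧸ N₁) := Module.Finite.quotient ℤ N₁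
  obtain ⟨r, hr1, hr⟩ := Submodule.exists_sub_one_mem_and_smul_eq_zero_of_fg_of_le_smul
    (Ideal.span {(ℓ : ℤ)}) ⊤ Module.Finite.fg_top hle
  have hr0 : r ≠ 0 := by
    rintro rfl
    rw [zero_sub, Ideal.mem_span_singleton, dvd_neg] at hr1
    have h1 : (ℓ : ℤ) = 1 := Int.eq_one_of_dvd_one (by positivity) hr1
    exact hℓ.ne_one (by exact_mod_cast h1)
  -- Step 3: `r • f ∈ ℤ • 𝟙` with `r ≠ 0` forces `f ∈ ℤ • 𝟙`
  intro f
  have h0 : Submodule.Quotient.mk (p := N₁) (r • f) = 0 := by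
    rw [Submodule.Quotient.mk_smul]; exact hr _ Submodule.mem_top
  rw [Submodule.Quotient.mk_eq_zero, hN₁, Submodule.mem_span_singleton] at h0
  obtain ⟨m, hm⟩ := h0
  exact end_eq_zsmul_id_of_zsmul_eq A hA hr0 hm.symm

/-- **`End_K(A) = ℤ` for an abelian variety whose `2`-torsion realises `A₅(b)`** (the `K`-rational part of
"Moreover, `End(B_ℚ̄) = ℤ`" in Boxer–Calegari–Gee–Pilloni 2025, Lemma 9.4.2, which is deduced there from
(2)(d) "`ρ̄_{B,2}` has image `S₅(b)`" by Zarhin 2000 [MR1748293]): if `A/K`, `char K = 0`, admits an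
additive frame `e : A[2](K̄) ≃ 𝔽₂⁴` in which every even `σ ∈ S₅` is realised by a Galois element
(`A₅(b) ⊆ im ρ̄_{A,2}` in the frame of `V = U⁰/L`, §8.1), then every `K`-endomorphism of `A` is `n · 𝟙`:
such a frame forces `#A[2] = 16`, i.e. `dim A = 2`; `K`-endomorphisms act on `A[2]` by `0` or `1`
(`geomPointsMap_eq_zero_or_eq_self_of_s5bFrame`, Lemma 8.1.1 / Schur), and
`forall_end_eq_zsmul_id_of_forall_geomTorsion_eq_zsmul` (Zarhin 2000, §3) concludes.  In particular the
endomorphism clause of `bcgp_switch_exists_modular_abelianSurface` needs only Lemma 9.4.2 (2)(d), not its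
"Moreover".
[cite: BoxerCalegariGeePilloni2025, Lemma 9.4.2 (2)(d) and "Moreover"; Lemma 8.1.1] [cite: Zarhin2000, §3 and §1] -/
theorem _root_.Literature.AlgebraicGeometry.Motives.AbelianVariety.forall_end_eq_zsmul_id_of_s5bFrame
    {K : Type u} [Field K] [CharZero K] (A : AbelianVariety K)
    (e : A.geomTorsion (2 : ℕ) ≃+ (Fin 4 → ZMod 2))
    (he : ∀ σ : Perm (Fin 5), Equiv.Perm.sign σ = 1 →
      ∃ g : Field.absoluteGaloisGroup K,
        ∀ P : A.geomTorsion (2 : ℕ), e (g • P) = s5bMatrix σ *ᵥ e P) :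
    ∀ f : A ⟶ A, ∃ n : ℤ, f = n • 𝟙 A := by
  -- `dim A = 2` from `#A[2](K̄) = #𝔽₂⁴ = 16 = 2 ^ (2 dim A)`
  have h2K : (((2 : ℕ) : ℤ) : K) ≠ 0 := by norm_num
  have hcard := A.natCard_geomTorsion (natCard_torsionPoints_of_isAlgClosed_holds A _) ((2 : ℕ) : ℤ) h2K
  rw [Nat.card_congr e.toEquiv, Int.natAbs_natCast, Nat.card_fun, Nat.card_zmod,
    Nat.card_eq_fintype_card, Fintype.card_fin] at hcard
  have hdim : 0 < A.dim := by
    have h4 := Nat.pow_right_injective (le_refl 2) hcard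
    omega
  haveI : Fact (Nat.Prime 2) := ⟨Nat.prime_two⟩
  refine A.forall_end_eq_zsmul_id_of_forall_geomTorsion_eq_zsmul hdim 2 fun f => ?_
  rcases A.geomPointsMap_eq_zero_or_eq_self_of_s5bFrame e he f with h0 | h1
  · exact ⟨0, fun P hP => by rw [h0 P hP, zero_smul]⟩
  · exact ⟨1, fun P hP => by rw [h1 P hP, one_smul]⟩

end EndFromTwoTorsion

section FromIngredientsABCD

open CategoryTheory IsDedekindDomain Literature.NumberTheory.Automorphic

/-- **`bcgp_switch_exists_modular_abelianSurface` from Lemma 9.4.2 (2)(a)–(d) — WITHOUT its "Moreover" —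
and Theorem 8.3.2.**  Same as `bcgp_switch_exists_modular_abelianSurface_of_lemma942_of_theorem832` (Part 10:
the first half of the proof of Thm. 9.5.2, formalised), except that hypothesis `h₁` is now only the printed
items (2)(a)–(d) of Lemma 9.4.2 (p. 135): the endomorphism clause `End_ℚ(B) = ℤ · 𝟙` of the fact is no
longer imported from "Moreover, `End(B_ℚ̄) = ℤ`" (which loc. cit. deduces from (d) by Zarhin 2000
[MR1748293]) but PROVED here from (d): `A₅(b) ⊆ im ρ̄_{B,2}` makes `B[2]` absolutely irreducible
(Lemma 8.1.1, `span_s5bMatrix_even_eq_top`), so `ℚ`-endomorphisms act on `B[2]` by scalars and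
`End_ℚ(B) ⊗ ℤ/2 = 𝔽₂ · I`, whence `End_ℚ(B)` has rank `1` and is `ℤ` (Zarhin 2000, §3 and §1;
`AbelianVariety.forall_end_eq_zsmul_id_of_s5bFrame`, via Milne's Lemma 12.6, the finite generation of
`End(B)` (Mumford §19, Thm. 3) and Nakayama).  Thus the fact is Lemma 9.4.2 (2)(a)–(d) ∘ Thm. 8.3.2, with
Zarhin's theorem removed from its inputs.
[cite: BoxerCalegariGeePilloni2025, proof of Thm. 9.5.2 (first half); Lemma 9.4.2 (2)(a)–(d); Thm. 8.3.2; Remark 1.8.9, §1.8.10, Def. 1.8.12; §8.1, Lemma 8.1.1; Def. 1.8.8; Def. 9.1.2]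
[cite: Zarhin2000, §3 and §1] [cite: GrothendieckSGA7IX, Exp. IX §3, 3.5 (semistable reduction in Galois form)] -/
theorem bcgp_switch_exists_modular_abelianSurface_of_lemma942abcd_of_theorem832
    (h₁ :
      ∀ (ρb : FramedGaloisRep ℚ (ZMod 3) 4),
        ρb.IsSymplecticWithMultiplierFun
            (fun g => (((modPCyclotomicCharacterZMod ℚ 3 g)⁻¹ : (ZMod 3)ˣ) : ZMod 3)) →
        (∀ v : HeightOneSpectrum (𝓞 ℚ), ((3 : ℕ) : 𝓞 ℚ) ∈ v.asIdeal →
          ModPGaloisRep.IsPeuRamifie (ρb.toLocal v) ∧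
          ∃ g : GL (Fin 4) (ZMod 3),
            (∀ (τ : Field.absoluteGaloisGroup (v.adicCompletion ℚ)) (i j : Fin 4),
                2 ≤ (i : ℕ) → (j : ℕ) < 2 → (g * ρb.toLocal v τ * g⁻¹).val i j = 0) ∧
            (∀ τ ∈ absInertia (v.adicCompletion ℚ), ∀ i j : Fin 4, (i : ℕ) < 2 → (j : ℕ) < 2 →
                (g * ρb.toLocal v τ * g⁻¹).val i j = if i = j then 1 else 0) ∧
            (∀ τ ∈ absInertia (v.adicCompletion ℚ), ∀ i j : Fin 4, 2 ≤ (i : ℕ) → 2 ≤ (j : ℕ) →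
                (g * ρb.toLocal v τ * g⁻¹).val i j =
                  if i = j then
                    (((modPCyclotomicCharacterZMod ℚ 3 (absGaloisRestrict ℚ (v.adicCompletion ℚ) τ))⁻¹ :
                        (ZMod 3)ˣ) : ZMod 3)
                  else 0)) →
        (∀ v : HeightOneSpectrum (𝓞 ℚ), ((2 : ℕ) : 𝓞 ℚ) ∈ v.asIdeal →
          ρb.IsUnramifiedAt v ∧
            ∀ Q : Polynomial (ZMod 3), ρb.HasFrobCharpolyAt v Q →
              Q ≠ (Polynomial.X ^ 2 + Polynomial.X + 2) ^ 2 ∧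
                Q ≠ (Polynomial.X ^ 2 - Polynomial.X + 2) ^ 2) →
        ∃ B : AbelianVariety ℚ,
          B.dim = 2 ∧
          (∃ e₃ : B.geomTorsion (3 : ℕ) ≃+ (Fin 4 → ZMod 3),
            ∀ (g : Field.absoluteGaloisGroup ℚ) (P : B.geomTorsion (3 : ℕ)),
              e₃ (g • P) =
                ((ρb g⁻¹ : GL (Fin 4) (ZMod 3)) : Matrix (Fin 4) (Fin 4) (ZMod 3))ᵀ *ᵥ e₃ P) ∧
          (∀ (ℓ : ℕ) [Fact ℓ.Prime], ℓ ≠ 2 →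
            ∀ v : HeightOneSpectrum (𝓞 ℚ), ((2 : ℕ) : 𝓞 ℚ) ∈ v.asIdeal →
              ∀ τ ∈ absInertia (v.adicCompletion ℚ),
                (B.rationalTateRep ℓ (absGaloisRestrict ℚ (v.adicCompletion ℚ) τ) - 1) ^ 2 = 0) ∧
          (∀ (b₂ : Module.Basis (Fin 4) ℚ_[2] (B.rationalTateModule 2))
              (r₂ : FramedGaloisRep ℚ (PadicAlgCl 2) 4),
              (∀ g : Field.absoluteGaloisGroup ℚ,
                (r₂ g).val =
                  ((LinearMap.toMatrix b₂ b₂ (B.rationalTateRep 2 g⁻¹)).map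
                    (algebraMap ℚ_[2] (PadicAlgCl 2))).transpose) →
              ∀ v : HeightOneSpectrum (𝓞 ℚ), ((2 : ℕ) : 𝓞 ℚ) ∈ v.asIdeal →
                r₂.IsOrdinaryPDistinguishedAt v) ∧
          (∀ v : HeightOneSpectrum (𝓞 ℚ), ((3 : ℕ) : 𝓞 ℚ) ∈ v.asIdeal →
            B.HasGoodOrdinaryReductionAt v) ∧
          (∃ e₂ : B.geomTorsion (2 : ℕ) ≃+ (Fin 4 → ZMod 2),
            (∀ g : Field.absoluteGaloisGroup ℚ, ∃ σ : Equiv.Perm (Fin 5),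
                ∀ P : B.geomTorsion (2 : ℕ), e₂ (g • P) = s5bMatrix σ *ᵥ e₂ P) ∧
            (∀ σ : Equiv.Perm (Fin 5), ∃ g : Field.absoluteGaloisGroup ℚ,
                ∀ P : B.geomTorsion (2 : ℕ), e₂ (g • P) = s5bMatrix σ *ᵥ e₂ P) ∧
            (∀ c : Field.absoluteGaloisGroup ℚ, IsComplexConjugation (algebraMap ℚ ℝ) c →
                ∃ σ : Equiv.Perm (Fin 5), σ.cycleType = {2, 2} ∧
                  ∀ P : B.geomTorsion (2 : ℕ), e₂ (c • P) = s5bMatrix σ *ᵥ e₂ P)))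
    (h₂ :
      ∀ (B : AbelianVariety ℚ), B.dim = 2 →
        (∃ e : B.geomTorsion (2 : ℕ) ≃+ (Fin 4 → ZMod 2),
          (∀ g : Field.absoluteGaloisGroup ℚ, ∃ σ : Equiv.Perm (Fin 5),
              ∀ P : B.geomTorsion (2 : ℕ), e (g • P) = s5bMatrix σ *ᵥ e P) ∧
          (∀ σ : Equiv.Perm (Fin 5), Equiv.Perm.sign σ = 1 →
              ∃ g : Field.absoluteGaloisGroup ℚ,
                ∀ P : B.geomTorsion (2 : ℕ), e (g • P) = s5bMatrix σ *ᵥ e P) ∧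
          (∀ c : Field.absoluteGaloisGroup ℚ, IsComplexConjugation (algebraMap ℚ ℝ) c →
              ∃ σ : Equiv.Perm (Fin 5), σ.cycleType = {2, 2} ∧
                ∀ P : B.geomTorsion (2 : ℕ), e (c • P) = s5bMatrix σ *ᵥ e P)) →
        (∀ (ℓ : ℕ) [Fact ℓ.Prime], ℓ ≠ 2 →
          ∀ v : HeightOneSpectrum (𝓞 ℚ), ((2 : ℕ) : 𝓞 ℚ) ∈ v.asIdeal →
            ∀ τ ∈ absInertia (v.adicCompletion ℚ),
              (B.rationalTateRep ℓ (absGaloisRestrict ℚ (v.adicCompletion ℚ) τ) - 1) ^ 2 = 0) →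
        (∀ (b₂ : Module.Basis (Fin 4) ℚ_[2] (B.rationalTateModule 2))
            (r₂ : FramedGaloisRep ℚ (PadicAlgCl 2) 4),
            (∀ g : Field.absoluteGaloisGroup ℚ,
              (r₂ g).val =
                ((LinearMap.toMatrix b₂ b₂ (B.rationalTateRep 2 g⁻¹)).map
                  (algebraMap ℚ_[2] (PadicAlgCl 2))).transpose) →
            ∀ v : HeightOneSpectrum (𝓞 ℚ), ((2 : ℕ) : 𝓞 ℚ) ∈ v.asIdeal →
              r₂.IsOrdinaryPDistinguishedAt v) →
        ∀ (p : ℕ) [Fact p.Prime] (b : Module.Basis (Fin 4) ℚ_[p] (B.rationalTateModule p))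
          (r : FramedGaloisRep ℚ (PadicAlgCl p) 4),
          (∀ g : Field.absoluteGaloisGroup ℚ,
            (r g).val =
              ((LinearMap.toMatrix b b (B.rationalTateRep p g⁻¹)).map
                (algebraMap ℚ_[p] (PadicAlgCl p))).transpose) →
          ∀ (hcpt : isCompact_glFiniteIntegralLevel 4 ℚ) (ι : PadicAlgCl p ≃+* ℂ),
            ∃ π : CuspidalAutomorphicRepData 4 ℚ hcpt, π.1.IsLAlgebraic ∧
              ∀ᶠ v : HeightOneSpectrum (𝓞 ℚ) in Filter.cofinite, ∃ a : Multiset ℂ,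
                π.1.HasSatakeParamAt v a ∧ r.IsUnramifiedAt v ∧
                  r.HasFrobCharpolyAt v (arithFrobPolyOfSatake ι v.residueCard 1 a)) :
    bcgp_switch_exists_modular_abelianSurface := by
  intro ρb hS h₃ h₂'
  obtain ⟨B, hdim, ⟨e₃, he₃⟩, hss, hord, hgood, e₂, him, hsurj, hcc⟩ := h₁ ρb hS h₃ h₂'
  have hmod := h₂ B hdim ⟨e₂, him, fun σ _ => hsurj σ, hcc⟩ hss hord
  -- End_ℚ(B) = ℤ · 𝟙 from (d) alone (A₅(b) ⊆ image): Lemma 8.1.1 / Schur + Zarhin 2000, §3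
  have hEnd : ∀ f : B ⟶ B, ∃ n : ℤ, f = n • 𝟙 B :=
    B.forall_end_eq_zsmul_id_of_s5bFrame e₂ fun σ _ => hsurj σ
  refine ⟨B, hdim, hgood, hEnd, fun b r hr => ⟨?_, ?_⟩⟩
  · exact bcgp_switch_charpolyClause B hdim ρb ⟨e₃, he₃⟩ b r hr
  · intro hcpt ι
    exact hmod 3 b r hr hcpt ι


/-- Part 10's hypothesis `h₁` (Lemma 9.4.2 (2) WITH "Moreover") trivially implies the Moreover-free `h₁`
of `bcgp_switch_exists_modular_abelianSurface_of_lemma942abcd_of_theorem832`; recorded as the statement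
that the geometric "Moreover" is not needed for the fact: any `B` witnessing (2)(a)–(d) already has
`End_ℚ(B) = ℤ · 𝟙` (`AbelianVariety.forall_end_eq_zsmul_id_of_s5bFrame`).
[cite: BoxerCalegariGeePilloni2025, Lemma 9.4.2 (2)(d) and "Moreover"] [cite: Zarhin2000, §3 and §1] -/
theorem bcgp_lemma942d_endClause (B : AbelianVariety ℚ)
    (hd : ∃ e₂ : B.geomTorsion (2 : ℕ) ≃+ (Fin 4 → ZMod 2),
      (∀ g : Field.absoluteGaloisGroup ℚ, ∃ σ : Equiv.Perm (Fin 5),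
          ∀ P : B.geomTorsion (2 : ℕ), e₂ (g • P) = s5bMatrix σ *ᵥ e₂ P) ∧
      (∀ σ : Equiv.Perm (Fin 5), ∃ g : Field.absoluteGaloisGroup ℚ,
          ∀ P : B.geomTorsion (2 : ℕ), e₂ (g • P) = s5bMatrix σ *ᵥ e₂ P) ∧
      (∀ c : Field.absoluteGaloisGroup ℚ, IsComplexConjugation (algebraMap ℚ ℝ) c →
          ∃ σ : Equiv.Perm (Fin 5), σ.cycleType = {2, 2} ∧
            ∀ P : B.geomTorsion (2 : ℕ), e₂ (c • P) = s5bMatrix σ *ᵥ e₂ P)) :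
    ∀ f : B ⟶ B, ∃ n : ℤ, f = n • 𝟙 B := by
  obtain ⟨e₂, -, hsurj, -⟩ := hd
  exact B.forall_end_eq_zsmul_id_of_s5bFrame e₂ fun σ _ => hsurj σ

end FromIngredientsABCD

/-! ## Part 12 (appended). Schur for absolutely irreducible matrix representations;
## `A[ℓ]` absolutely irreducible ⟹ `End_K(A) = ℤ` (Zarhin 2000, §1, general form)

Part 11 derived `End_ℚ(B) = ℤ · 𝟙` from the `A₅(b)`-frame of `B[2]` through the explicit Burnside
statement for `s5bMatrix`.  The underlying principle is general and is recorded here for any abelian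
variety: Zarhin 2000, §1 — "Notice that it easily follows that the ring of `K`-endomorphisms of `J(C)`
coincides with `ℤ`" — i.e. **if `A[ℓ](K̄)` is an absolutely irreducible `𝔽_ℓ[Γ_K]`-module then
`End_K(A) = ℤ`** (`AbelianVariety.forall_end_eq_zsmul_id_of_isAbsIrreducible_torsionFrame`, characteristic
`0`), via Schur's lemma for absolutely irreducible matrix representations
(`IsAbsIrreducible.exists_eq_scalar_of_forall_commute`, from Mathlib's Schur lemma over algebraically closed
fields) and Part 11's `AbelianVariety.forall_end_eq_zsmul_id_of_forall_geomTorsion_eq_zsmul`.  With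
`isAbsIrreducible_of_forall_even_exists_eq_s5bMatrix` (`GenusTwoTwoTorsionS5bProofs`, Lemma 8.1.1) this
re-proves Part 11's `forall_end_eq_zsmul_id_of_s5bFrame` for any HOMOMORPHISM `ρ̄_{B,2}` containing `A₅(b)`;
contrapositively, an abelian variety with `End_K(A) ≠ ℤ` (e.g. real multiplication over `K`) has NO
absolutely irreducible `A[ℓ](K̄)`, for any `ℓ`. -/

section SchurAbsIrreducible

open CategoryTheory Matrix
open Literature.AlgebraicGeometry.Motives.AbelianVariety.Hom

universe u u' w

/-- **Schur's lemma for absolutely irreducible matrix representations.**  If `σ : G → GL_n(k)` is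
absolutely irreducible (`IsAbsIrreducible`: irreducible after every extension of scalars) then every
matrix commuting with all `σ(g)` is a scalar.  Proof: over `k̄ = AlgebraicClosure k` the base change
`M ⊗ k̄` is a self-intertwiner of the irreducible `σ ⊗ k̄`, hence a scalar `c · 1` by Mathlib's Schur
lemma over algebraically closed fields
(`Representation.IsIrreducible.algebraMap_intertwiningMap_bijective_of_isAlgClosed`); comparing entries
along the injective `k → k̄` shows `M` is already the scalar `M₀₀`.  (Curtis–Reiner, *Representation theory
of finite groups and associative algebras* (1962), §29, (29.13); recorded as folklore.) [folklore] -/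
theorem _root_.Literature.NumberTheory.GaloisRepresentations.IsAbsIrreducible.exists_eq_scalar_of_forall_commute
    {G : Type u'} [Group G] {k : Type w} [Field k] {n : ℕ} {σ : G →* GL (Fin n) k}
    (hσ : IsAbsIrreducible σ) {M : Matrix (Fin n) (Fin n) k}
    (hM : ∀ g : G, Commute ((σ g : GL (Fin n) k) : Matrix (Fin n) (Fin n) k) M) :
    ∃ c : k, M = Matrix.scalar (Fin n) c := by
  classical
  rcases Nat.eq_zero_or_pos n with hn | hn
  · subst hn
    exact ⟨0, Subsingleton.elim _ _⟩
  let k' := AlgebraicClosure k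
  let f : k →+* k' := algebraMap k k'
  let ρ' := glRepresentation ((Matrix.GeneralLinearGroup.map f).comp σ)
  haveI : ρ'.IsIrreducible := hσ k' f
  have hcomm' : ∀ g : G,
      ((((Matrix.GeneralLinearGroup.map f).comp σ) g : GL (Fin n) k') : Matrix (Fin n) (Fin n) k') *
          M.map f =
        M.map f * (((Matrix.GeneralLinearGroup.map f).comp σ) g : GL (Fin n) k') := by
    intro g
    have h := congrArg (fun N : Matrix (Fin n) (Fin n) k => N.map f) (hM g).eq
    simp only [Matrix.map_mul] at h
    exact h
  -- `M ⊗ k̄` as a self-intertwiner of `σ ⊗ k̄`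
  let T : ρ'.IntertwiningMap ρ' :=
    LinearMap.intertwiningMap_of_isIntertwiningMap ρ' ρ' (Matrix.toLin' (M.map f)) (fun g v => by
      rw [glRepresentation_apply_apply, glRepresentation_apply_apply, Matrix.toLin'_apply,
        Matrix.toLin'_apply, Matrix.mulVec_mulVec, Matrix.mulVec_mulVec, hcomm' g])
  obtain ⟨c, hc⟩ :=
    (Representation.IsIrreducible.algebraMap_intertwiningMap_bijective_of_isAlgClosed (ρ := ρ')).2 T
  -- so `M.map f = c • 1`
  have hT : ∀ v : Fin n → k', M.map f *ᵥ v = c • v := by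
    intro v
    have h := congrArg (fun S : ρ'.IntertwiningMap ρ' => (S : (Fin n → k') → Fin n → k') v) hc
    simp only [Representation.IntertwiningMap.algebraMap_apply,
      Representation.IntertwiningMap.coe_smul, Representation.IntertwiningMap.coe_one,
      Pi.smul_apply, id] at h
    -- `h : c • v = T v`
    rw [h]
    rfl
  have hMf : M.map f = c • (1 : Matrix (Fin n) (Fin n) k') := by
    have h1 : Matrix.toLin' (M.map f) = c • LinearMap.id := by
      refine LinearMap.ext fun v => ?_
      rw [Matrix.toLin'_apply, hT, LinearMap.smul_apply, LinearMap.id_apply]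
    have h2 := congrArg LinearMap.toMatrix' h1
    rwa [LinearMap.toMatrix'_toLin', map_smul, LinearMap.toMatrix'_id] at h2
  have hent : ∀ j l : Fin n, f (M j l) = if j = l then c else 0 := by
    intro j l
    have h := congrFun (congrFun hMf j) l
    rw [Matrix.map_apply, Matrix.smul_apply, Matrix.one_apply, smul_eq_mul, mul_ite, mul_one,
      mul_zero] at h
    exact h
  have hf : Function.Injective f := (algebraMap k k').injective
  let i : Fin n := ⟨0, hn⟩
  refine ⟨M i i, Matrix.ext fun j l => ?_⟩
  rw [Matrix.scalar_apply, Matrix.diagonal_apply]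
  by_cases hjl : j = l
  · subst hjl
    rw [if_pos rfl]
    apply hf
    rw [hent, hent, if_pos rfl, if_pos rfl]
  · rw [if_neg hjl]
    apply hf
    rw [hent, if_neg hjl, map_zero]

/-- **`A[ℓ](K̄)` absolutely irreducible ⟹ `End_K(A) = ℤ`** (Zarhin 2000, §1: "Notice that it easily
follows that the ring of `K`-endomorphisms of `J(C)` coincides with `ℤ`", in general form).  Let `A/K` be
an abelian variety over a field of characteristic `0`, `ℓ` a prime, and `e : A[ℓ](K̄) ≃ 𝔽_ℓ^d` an additive
frame in which `Γ_K` acts through a homomorphism `ρ : Γ_K → GL_d(𝔽_ℓ)` (`e (g • P) = ρ(g) · e P`) that is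
absolutely irreducible (`IsAbsIrreducible`).  Then every `K`-endomorphism of `A` is `n · 𝟙`, `n ∈ ℤ`:
a `K`-endomorphism commutes with `Γ_K` on `A(K̄)`, so its matrix on `A[ℓ]` commutes with `ρ(Γ_K)` and is
a scalar by Schur (`IsAbsIrreducible.exists_eq_scalar_of_forall_commute`) — "`End_K(A) ⊗ ℤ/ℓ ⊂
End_{Gal}(A[ℓ]) = 𝔽_ℓ`" — and `forall_end_eq_zsmul_id_of_forall_geomTorsion_eq_zsmul` (Zarhin 2000,
§3: Milne's Lemma 12.6, finite generation of `End(A)`, Nakayama; rank `1`) concludes.  (`d ≥ 1` and hence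
`dim A ≥ 1` are forced by irreducibility.)
[cite: Zarhin2000, §1 and §3 (proof of Thm. 2.1)] -/
theorem _root_.Literature.AlgebraicGeometry.Motives.AbelianVariety.forall_end_eq_zsmul_id_of_isAbsIrreducible_torsionFrame
    {K : Type u} [Field K] [CharZero K] (A : AbelianVariety K) (ℓ : ℕ) [Fact ℓ.Prime] {d : ℕ}
    (e : A.geomTorsion (ℓ : ℕ) ≃+ (Fin d → ZMod ℓ))
    (ρ : Field.absoluteGaloisGroup K →* GL (Fin d) (ZMod ℓ))
    (he : ∀ (g : Field.absoluteGaloisGroup K) (P : A.geomTorsion (ℓ : ℕ)),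
      e (g • P) = ((ρ g : GL (Fin d) (ZMod ℓ)) : Matrix (Fin d) (Fin d) (ZMod ℓ)) *ᵥ e P)
    (hρ : IsAbsIrreducible ρ) :
    ∀ f : A ⟶ A, ∃ n : ℤ, f = n • 𝟙 A := by
  classical
  have hℓ : ℓ.Prime := Fact.out
  -- `d ≥ 1` (an irreducible representation is nonzero), hence `dim A ≥ 1`
  have hd : 0 < d := by
    rcases Nat.eq_zero_or_pos d with hd0 | hd0
    · exfalso
      subst hd0
      have hirr := hρ (ZMod ℓ) (RingHom.id _)
      haveI := hirr
      have hnt : Nontrivial (Subrepresentation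
          (glRepresentation ((Matrix.GeneralLinearGroup.map (RingHom.id (ZMod ℓ))).comp ρ))) :=
        inferInstance
      obtain ⟨S₁, S₂, hne⟩ := hnt.exists_pair_ne
      apply hne
      apply Subrepresentation.toSubmodule_injective
      exact Subsingleton.elim _ _
    · exact hd0
  have hℓK : (((ℓ : ℕ) : ℤ) : K) ≠ 0 := by exact_mod_cast hℓ.ne_zero
  have hdim : 0 < A.dim := by
    have hcard := A.natCard_geomTorsion (natCard_torsionPoints_of_isAlgClosed_holds A _) ((ℓ : ℕ) : ℤ) hℓK
    rw [Nat.card_congr e.toEquiv, Int.natAbs_natCast, Nat.card_fun, Nat.card_zmod,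
      Nat.card_eq_fintype_card, Fintype.card_fin] at hcard
    -- `hcard : ℓ ^ d = ℓ ^ (2 * A.dim)`
    have h := Nat.pow_right_injective hℓ.two_le hcard
    omega
  refine A.forall_end_eq_zsmul_id_of_forall_geomTorsion_eq_zsmul hdim ℓ fun f => ?_
  -- `f` preserves `A[ℓ]`; transport its restriction through the frame
  have hmem : ∀ P ∈ A.geomTorsion (ℓ : ℕ), geomPointsMap f P ∈ A.geomTorsion (ℓ : ℕ) := by
    intro P hP
    rw [mem_geomTorsion_iff'] at hP ⊢
    rw [← map_zsmul, hP, map_zero]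
  set fT : A.geomTorsion (ℓ : ℕ) →+ A.geomTorsion (ℓ : ℕ) :=
    ((geomPointsMap f).restrict (A.geomTorsion (ℓ : ℕ))).codRestrict (A.geomTorsion (ℓ : ℕ))
      (fun P => hmem P P.2) with hfT
  have hfT_coe : ∀ P : A.geomTorsion (ℓ : ℕ),
      ((fT P : A.geomTorsion (ℓ : ℕ)) : A.geomPoints) = geomPointsMap f P := fun P => rfl
  have hfT_smul : ∀ (g : Field.absoluteGaloisGroup K) (P : A.geomTorsion (ℓ : ℕ)),
      fT (g • P) = g • fT P := by
    intro g P
    apply Subtype.ext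
    rw [hfT_coe, AddSubgroup.torsionBy.coe_smul, AddSubgroup.torsionBy.coe_smul, geomPointsMap_smul,
      hfT_coe]
  set F : (Fin d → ZMod ℓ) →+ (Fin d → ZMod ℓ) :=
    e.toAddMonoidHom.comp (fT.comp e.symm.toAddMonoidHom) with hFdef
  have hF_apply : ∀ P : A.geomTorsion (ℓ : ℕ), F (e P) = e (fT P) := by
    intro P
    simp only [hFdef, AddMonoidHom.coe_comp, AddEquiv.coe_toAddMonoidHom, Function.comp_apply,
      AddEquiv.symm_apply_apply]
  -- the matrix `N` of `F` commutes with `ρ(Γ_K)`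
  set Fl : (Fin d → ZMod ℓ) →ₗ[ZMod ℓ] (Fin d → ZMod ℓ) := F.toZModLinearMap ℓ with hFl
  have hFl_apply : ∀ x, Fl x = F x := fun x => rfl
  set N : Matrix (Fin d) (Fin d) (ZMod ℓ) := LinearMap.toMatrix' Fl with hN
  have hNx : ∀ x, N *ᵥ x = F x := fun x => by
    rw [hN, LinearMap.toMatrix'_mulVec, hFl_apply]
  have hFρ : ∀ (g : Field.absoluteGaloisGroup K) (x : Fin d → ZMod ℓ),
      F (((ρ g : GL (Fin d) (ZMod ℓ)) : Matrix (Fin d) (Fin d) (ZMod ℓ)) *ᵥ x) =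
        ((ρ g : GL (Fin d) (ZMod ℓ)) : Matrix (Fin d) (Fin d) (ZMod ℓ)) *ᵥ F x := by
    intro g x
    obtain ⟨P, rfl⟩ := e.surjective x
    rw [← he g P, hF_apply, hF_apply, hfT_smul, he]
  have hcomm : ∀ g : Field.absoluteGaloisGroup K,
      Commute ((ρ g : GL (Fin d) (ZMod ℓ)) : Matrix (Fin d) (Fin d) (ZMod ℓ)) N := by
    intro g
    have h : Fl ∘ₗ Matrix.toLin' ((ρ g : GL (Fin d) (ZMod ℓ)) : Matrix (Fin d) (Fin d) (ZMod ℓ)) =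
        Matrix.toLin' ((ρ g : GL (Fin d) (ZMod ℓ)) : Matrix (Fin d) (Fin d) (ZMod ℓ)) ∘ₗ Fl := by
      refine LinearMap.ext fun x => ?_
      simp only [LinearMap.comp_apply, Matrix.toLin'_apply, hFl_apply, hFρ g]
    have h2 := congrArg LinearMap.toMatrix' h
    rw [LinearMap.toMatrix'_comp, LinearMap.toMatrix'_comp, LinearMap.toMatrix'_toLin'] at h2
    exact h2.symm
  -- Schur: `N` is a scalar `c`
  obtain ⟨c, hc⟩ := hρ.exists_eq_scalar_of_forall_commute hcomm
  have hsc : ∀ v : Fin d → ZMod ℓ, N *ᵥ v = (c.val : ℤ) • v := by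
    intro v
    rw [hc, ← Int.cast_smul_eq_zsmul (ZMod ℓ), Int.cast_natCast, ZMod.natCast_zmod_val]
    ext x
    rw [Matrix.scalar_apply, Matrix.mulVec_diagonal, Pi.smul_apply, smul_eq_mul]
  refine ⟨(c.val : ℤ), fun P hP => ?_⟩
  have h := hF_apply ⟨P, hP⟩
  rw [← hNx, hsc, ← map_zsmul] at h
  have h' := congrArg Subtype.val (e.injective h).symm
  rw [hfT_coe] at h'
  rw [h', AddSubgroup.coe_zsmul]

end SchurAbsIrreducible

/-! ## Part 13 (appended). The fact from its two NAMED published ingredients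

Since the librarian's vend (sweep g26) the two printed ingredients of the fact exist in the tree as
named facts, each in its own file, with bodies VERBATIM the binders `h₁`, `h₂` of Part 11's reduction:
`bcgp_switchingSurface_exists` (`BcgpSwitchingSurface.lean`; Lemma 9.4.2 (2)(a)–(d), Moreover-free) and
`bcgp_residuallyA5b_modular_abelianSurface` (`BcgpResiduallyA5bModular.lean`; Thm. 8.3.2 in the `GL₄`
form of Remark 1.8.9 / §1.8.10 / Def. 1.8.12).  The theorem below is the kernel-checked statement that
`bcgp_switch_exists_modular_abelianSurface` is EXACTLY "Lemma 9.4.2 (2)(a)–(d) ∘ Thm. 8.3.2" (the first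
half of the proof of Thm. 9.5.2, p. 136–137), i.e. that the vended bodies are the binders and nothing
else is used: consumers holding `(h₁ : bcgp_switchingSurface_exists)` and
`(h₂ : bcgp_residuallyA5b_modular_abelianSurface)` obtain the fact in one line, and the day both
ingredients are theorems `_holds` is this theorem applied to their `_holds`.
-/

section FromNamedFacts

/-- **`bcgp_switch_exists_modular_abelianSurface` = Lemma 9.4.2 (2)(a)–(d) ∘ Theorem 8.3.2, with the
two ingredients as the tree's NAMED facts.**  From `bcgp_switchingSurface_exists` (BCGP 2025,
Lemma 9.4.2 (2)(a)–(d): the switching surface `B = Jac(X)` with `ρ̄_{B,3} ≅ ρ̄`, semistable-or-good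
ordinary `2`-distinguished at `2`, good ordinary at `3`, `im ρ̄_{B,2} = S₅(b)` with complex conjugation
a double transposition) and `bcgp_residuallyA5b_modular_abelianSurface` (loc. cit. Thm. 8.3.2,
`GL₄` form: such residually-`A₅(b)` surfaces are modular for every `p`), the fact follows by Part 11
(`bcgp_switch_exists_modular_abelianSurface_of_lemma942abcd_of_theorem832`: the End clause
`End_ℚ(B) = ℤ · 𝟙` is PROVED from (d), the characteristic-polynomial clause from (a), modularity is
Thm. 8.3.2 at `p = 3`).  This is the first half of the printed proof of Thm. 9.5.2.
[cite: BoxerCalegariGeePilloni2025, proof of Thm. 9.5.2 (first half), p. 136–137; Lemma 9.4.2 (2)(a)–(d); Thm. 8.3.2 with Remark 1.8.9, §1.8.10, Def. 1.8.12] -/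
theorem bcgp_switch_exists_modular_abelianSurface_of_switchingSurface_of_residuallyA5bModular
    (h₁ : bcgp_switchingSurface_exists) (h₂ : bcgp_residuallyA5b_modular_abelianSurface) :
    bcgp_switch_exists_modular_abelianSurface :=
  bcgp_switch_exists_modular_abelianSurface_of_lemma942abcd_of_theorem832 h₁ h₂

end FromNamedFacts

end Literature.NumberTheory.DiophantineGeometry

end
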